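import Literature.Computability.Complexity.OneInThreeSATMachine
import Literature.Computability.Complexity.DirectedHamiltonCircuit
import Literature.Computability.Complexity.ListBricks
import Literature.Combinatorics.SimpleGraph.HamiltonianSatGadget
import HarnessLib

/-!
# `3SAT ≤ₚ DIRECTED HAMILTON CIRCUIT` (Karp 1972, problem 9): the machine, and `isNPComplete_HAMCIRCUIT`

Machine half of the NP-hardness of DIRECTED HAMILTON CIRCUIT by the Arora–Barak chain construction
(Thm. 2.17; cycle form, separators as in Sipser's Thm. 7.46), whose combinatorial correctness is
`SatDHam.slotSat_iff_exists_isHamCycleListing` (`Combinatorics/SimpleGraph/HamiltonianSatGadget.lean`):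
on a canonical 3-CNF code `w` (guards `KSATRed.isCanonFn`, `KSATRed.widthLEFn 3`, and "no empty
clause") with `m` clauses, output the code (`encodingDigraph`) of the gadget digraph `SatDHam.Arc`
of the slot-CNF of `w` (clause `j`, slot `i ↦` literal `min (i, k_j - 1)` of clause `j`, as
`OneInThree.sOf`), on `1 + m + 18 m` numbered vertices; every other string is sent to a fixed
non-member. All in the tree's algebra of `FP` string functions:

* occurrence access (`occItemF`, `varF`, `polF`: the raw literal item of occurrence `a = 3 j + i`,
  through `OneInThree.slotF`), the primitive one-bit tests of the arc relation as bounded scans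
  (`Brick.allIdxFn`): equal variables, first / last / next occurrence, the order of first
  occurrences, and the Boolean mirror `arcB` of `SatDHam.Arc` (`arcB_eq_true_iff`);
* the tabulation of the `(1 + 19 m)²` arc bits (`Brick.foldLoop appF`) and the reduction
  `reduceFn ∈ FP`, `reduceFn_encode`;
* **`kSAT_three_karpReducible_DHAMCIRCUIT : kSAT 3 ≤ₚ DHAMCIRCUIT`**, and the assembly of Karp's
  Main Theorem for problem 10: **`isNPComplete_HAMCIRCUIT_holds`** from `isNPComplete_kSAT_three_holds`,
  `DHAMCIRCUIT_karpReducible_HAMCIRCUIT`, `HAMCIRCUIT_mem_NP`.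

## References

* R. M. Karp, *Reducibility among combinatorial problems*, 1972, §4 Main Theorem, problems 9, 10
  (`SATISFIABILITY ∝ … ∝ DIRECTED HAMILTON CIRCUIT ∝ HAMILTON CIRCUIT`).
* S. Arora, B. Barak, *Computational Complexity: A Modern Approach*, CUP 2009, Thm. 2.17, Ex. 2.18,
  §1.3 (closure of polynomial time under composition and bounded loops), §0.1 (codes).
* M. Sipser, *Introduction to the Theory of Computation*, 3rd ed., 2012, Thm. 7.46.
-/

noncomputable section

namespace Literature.Computability.Complexity

open _root_.Computability Polynomial Brick HashBricks NegCNF Ladder3 Plumb OneInThree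
open Literature.Combinatorics.SimpleGraph
open scoped Notation

namespace SatDHamRed

/-! ### Codes of 3-CNFs, field by field -/

/-- A literal code: canonical numeral and polarity bit. [cite: AroraBarakCC2009, §0.1] -/
theorem encodeLiteral_eq (l : Literal ℕ) : encodingLiteral.encode l = boolPair (encodeNat l.1) [l.2] := rfl

/-- A clause code: unary length and the list code of the literal codes. [cite: AroraBarakCC2009, §0.1] -/
theorem encodeClause_eq (c : Clause ℕ) :
    encodingClause.encode c = boolPair (ones c.length) (encList (c.map encodingLiteral.encode)) := by
  rw [show encodingClause = encodingLiteral.listBool from rfl, listBool_encode_eq_encList, unaryEncodeNat_eq_replicate]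

/-- A CNF code: unary number of clauses and the list code of the clause codes. [cite: AroraBarakCC2009, §0.1] -/
theorem encodeCNF_eq (φ : CNF ℕ) :
    encodingCNF.encode φ = boolPair (ones φ.length) (encList (φ.map encodingClause.encode)) := by
  rw [show encodingCNF = encodingClause.listBool from rfl, listBool_encode_eq_encList, unaryEncodeNat_eq_replicate]

/-- The number of clauses announced by the header. [folklore] -/
def mOf (w : List Bool) : ℕ := (fstF w).length

/-- On a code, `mOf` is the number of clauses. [folklore] -/
@[simp] theorem mOf_encode (φ : CNF ℕ) : mOf (encodingCNF.encode φ) = φ.length := by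
  rw [mOf, encodeCNF_eq, fstF_boolPair, List.length_replicate]

/-- The raw clause item `j` of a code is the code of clause `j`. [folklore] -/
theorem aOf_encode (φ : CNF ℕ) {j : ℕ} (hj : j < φ.length) :
    aOf (encodingCNF.encode φ) j = encodingClause.encode φ[j] := by
  rw [aOf, encodeCNF_eq, sndF_boolPair, Brick.sndF_iterate_encList, Brick.fstF_encList, ← List.map_drop,
    List.drop_eq_getElem_cons hj]
  rfl

/-- The literal count of clause `j` of a code. [folklore] -/
theorem kOf_encode (φ : CNF ℕ) {j : ℕ} (hj : j < φ.length) : kOf (encodingCNF.encode φ) j = φ[j].length := by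
  rw [kOf_eq, aOf_encode φ hj, encodeClause_eq, fstF_boolPair, List.length_replicate]

/-- The raw literal item `i` of clause `j` of a code is the code of that literal. [folklore] -/
theorem uOf_encode (φ : CNF ℕ) {j i : ℕ} (hj : j < φ.length) (hi : i < φ[j].length) :
    uOf (encodingCNF.encode φ) j i = encodingLiteral.encode (φ[j])[i] := by
  rw [uOf, aOf_encode φ hj, encodeClause_eq, sndF_boolPair, Brick.sndF_iterate_encList, Brick.fstF_encList,
    ← List.map_drop, List.drop_eq_getElem_cons hi]
  rfl

/-- **The slot literal**: literal `min (i, |c| - 1)` of the clause `c` (a clause with fewer than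
three literals repeats its last one). [cite: AroraBarakCC2009, Thm. 2.17 (proof)] -/
def slotLit (c : Clause ℕ) (i : ℕ) : Literal ℕ := c.getD (min i (c.length - 1)) (0, false)

/-- The slot literal is a literal of a nonempty clause. [folklore] -/
theorem slotLit_mem {c : Clause ℕ} (hc : c ≠ []) (i : ℕ) : slotLit c i ∈ c := by
  rw [slotLit, List.getD_eq_getElem _ _ (by have := List.length_pos_of_ne_nil hc; omega)]
  exact List.getElem_mem _

/-- A literal of a clause of width at most three is one of its slot literals. [folklore] -/
theorem exists_slotLit_eq {c : Clause ℕ} (hc3 : c.length ≤ 3) {l : Literal ℕ} (hl : l ∈ c) :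
    ∃ i : Fin 3, slotLit c i = l := by
  obtain ⟨p, hp, rfl⟩ := List.getElem_of_mem hl
  refine ⟨⟨p, by omega⟩, ?_⟩
  rw [slotLit, show min ((⟨p, by omega⟩ : Fin 3) : ℕ) (c.length - 1) = p from by simp; omega,
    List.getD_eq_getElem _ _ hp]

/-- The raw slot item of a code is the code of the slot literal. [folklore] -/
theorem sOf_encode (φ : CNF ℕ) {j : ℕ} (hj : j < φ.length) (hne : φ[j] ≠ []) (i : ℕ) :
    sOf (encodingCNF.encode φ) j i = encodingLiteral.encode (slotLit φ[j] i) := by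
  have hlen := List.length_pos_of_ne_nil hne
  rw [sOf, kOf_encode φ hj, uOf_encode φ hj (by omega), slotLit, List.getD_eq_getElem _ _ (by omega)]

/-! ### Occurrence access: the raw literal item of occurrence `a = 3 j + i` -/

/-- On `⟨w, 1ᵃ⟩`: `⟨1^{a / 3}, 1^{a mod 3}⟩`. [folklore] -/
def qrF : List Bool → List Bool := divModFn ∘ fanoutFn (fun _ => ones 3) sndF

/-- On `⟨w, 1ᵃ⟩`: the clause argument `⟨w, 1^{a / 3}⟩` of `OneInThree.slotF`. [folklore] -/
def qF : List Bool → List Bool := fanoutFn fstF (fstF ∘ qrF)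

/-- On `⟨w, 1ᵃ⟩`: the slot `1^{a mod 3}`. [folklore] -/
def rF : List Bool → List Bool := sndF ∘ qrF

/-- **On `⟨w, 1ᵃ⟩`: the raw literal item of occurrence `a`** (slot `a mod 3` of clause `a / 3`,
`OneInThree.slotF`, selected by the value of the slot). [cite: AroraBarakCC2009, §1.3] -/
def occItemF : List Bool → List Bool :=
  iteFn (isNilFn ∘ rF) (slotF 0 ∘ qF) (iteFn (eqPairFn ∘ fanoutFn rF fun _ => ones 1) (slotF 1 ∘ qF) (slotF 2 ∘ qF))

/-- On `⟨w, 1ᵃ⟩`: the raw variable field of occurrence `a`. [folklore] -/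
def varF : List Bool → List Bool := fstF ∘ occItemF

/-- On `⟨w, 1ᵃ⟩`: the polarity bit of occurrence `a`. [folklore] -/
def polF : List Bool → List Bool := headBitFn ∘ sndF ∘ occItemF

/-- `qrF ∈ FP`. [cite: AroraBarakCC2009, §1.3] -/
theorem qrF_mem_FP : qrF ∈ FP := comp_mem_FP divModFn_mem_FP (fanoutFn_mem_FP (const_mem_FP _) sndF_mem_FP)
/-- `qF ∈ FP`. [cite: AroraBarakCC2009, §1.3] -/
theorem qF_mem_FP : qF ∈ FP := fanoutFn_mem_FP fstF_mem_FP (comp_mem_FP fstF_mem_FP qrF_mem_FP)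
/-- `rF ∈ FP`. [cite: AroraBarakCC2009, §1.3] -/
theorem rF_mem_FP : rF ∈ FP := comp_mem_FP sndF_mem_FP qrF_mem_FP
/-- `occItemF ∈ FP`. [cite: AroraBarakCC2009, §1.3] -/
theorem occItemF_mem_FP : occItemF ∈ FP :=
  iteFn_mem_FP (comp_mem_FP isNilFn_mem_FP rF_mem_FP) (comp_mem_FP (slotF_mem_FP 0) qF_mem_FP)
    (iteFn_mem_FP (comp_mem_FP eqPairFn_mem_FP (fanoutFn_mem_FP rF_mem_FP (const_mem_FP _)))
      (comp_mem_FP (slotF_mem_FP 1) qF_mem_FP) (comp_mem_FP (slotF_mem_FP 2) qF_mem_FP))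
/-- `varF ∈ FP`. [cite: AroraBarakCC2009, §1.3] -/
theorem varF_mem_FP : varF ∈ FP := comp_mem_FP fstF_mem_FP occItemF_mem_FP
/-- `polF ∈ FP`. [cite: AroraBarakCC2009, §1.3] -/
theorem polF_mem_FP : polF ∈ FP := comp_mem_FP headBitFn_mem_FP (comp_mem_FP sndF_mem_FP occItemF_mem_FP)

/-- `qF ⟨w, 1ᵃ⟩ = ⟨w, 1^{a/3}⟩`. [folklore] -/
@[simp] theorem qF_boolPair (w : List Bool) (a : ℕ) : qF (boolPair w (ones a)) = boolPair w (ones (a / 3)) := by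
  simp [qF, qrF]

/-- `rF ⟨w, 1ᵃ⟩ = 1^{a mod 3}`. [folklore] -/
@[simp] theorem rF_boolPair (w : List Bool) (a : ℕ) : rF (boolPair w (ones a)) = ones (a % 3) := by
  simp [rF, qrF]

/-- **Value of `occItemF`**: the raw slot item `sOf w (a / 3) (a mod 3)`. [folklore] -/
theorem occItemF_boolPair (w : List Bool) (a : ℕ) : occItemF (boolPair w (ones a)) = sOf w (a / 3) (a % 3) := by
  have h3 : a % 3 < 3 := Nat.mod_lt _ (by norm_num)
  unfold occItemF
  by_cases h0 : a % 3 = 0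
  · rw [iteFn_apply_true (by simp [h0]), Function.comp_apply, qF_boolPair, slotF_boolPair, h0]
  · rw [iteFn_apply_false (by simp [isNilFn, ones, h0])]
    by_cases h1 : a % 3 = 1
    · rw [iteFn_apply_true (by simp [eqPairFn_boolPair, h1]), Function.comp_apply, qF_boolPair, slotF_boolPair, h1]
    · have h2 : a % 3 = 2 := by omega
      rw [iteFn_apply_false (by simp [eqPairFn_boolPair, ones, h2]), Function.comp_apply, qF_boolPair, slotF_boolPair,
        h2]

/-- The clause of an occurrence below `3 m` is below `m`. [folklore] -/
theorem div_three_lt_of_lt {a m : ℕ} (ha : a < 3 * m) : a / 3 < m := by omega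

section Values

variable (φ : CNF ℕ) (hne : ∀ c ∈ φ, c ≠ []) {a : ℕ} (ha : a < 3 * φ.length)
include hne ha

/-- **Value of `occItemF` on a code**: the code of the slot literal of occurrence `a`. [folklore] -/
theorem occItemF_encode :
    occItemF (boolPair (encodingCNF.encode φ) (ones a)) = encodingLiteral.encode (slotLit φ[a / 3] (a % 3)) := by
  rw [occItemF_boolPair, sOf_encode φ (div_three_lt_of_lt ha) (hne _ (List.getElem_mem _))]

/-- **Value of `varF` on a code**: the canonical numeral of the variable of occurrence `a`. [folklore] -/
theorem varF_encode :
    varF (boolPair (encodingCNF.encode φ) (ones a)) = encodeNat (slotLit φ[a / 3] (a % 3)).1 := by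
  rw [varF, Function.comp_apply, occItemF_encode φ hne ha, encodeLiteral_eq, fstF_boolPair]

/-- **Value of `polF` on a code**: the polarity of occurrence `a`. [folklore] -/
theorem polF_encode : polF (boolPair (encodingCNF.encode φ) (ones a)) = [(slotLit φ[a / 3] (a % 3)).2] := by
  rw [polF, Function.comp_apply, Function.comp_apply, occItemF_encode φ hne ha, encodeLiteral_eq, sndF_boolPair,
    headBitFn_apply]
  rfl

end Values

/-- `polF` is one-bit. [folklore] -/
theorem oneBit_polF : OneBit polF := oneBit_headBitFn.comp _

/-! ### One-bit values in `decide` form -/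

/-- `andFn` of `decide`s. [folklore] -/
theorem andFn_decide {c d : List Bool → List Bool} {z : List Bool} {P Q : Prop} [Decidable P] [Decidable Q]
    (h : c z = [decide P]) (h' : d z = [decide Q]) : andFn c d z = [decide (P ∧ Q)] := by
  rw [andFn_apply h h', Bool.decide_and]

/-- `orFn` of `decide`s. [folklore] -/
theorem orFn_decide {c d : List Bool → List Bool} {z : List Bool} {P Q : Prop} [Decidable P] [Decidable Q]
    (h : c z = [decide P]) (h' : d z = [decide Q]) : orFn c d z = [decide (P ∨ Q)] := by
  rw [orFn_apply h h', Bool.decide_or]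

/-- `notFn` of a `decide`. [folklore] -/
theorem notFn_decide {c : List Bool → List Bool} {z : List Bool} {P : Prop} [Decidable P] (h : c z = [decide P]) :
    notFn c z = [decide (¬P)] := by
  rw [notFn_apply h, decide_not]

/-- `allIdxFn` of a body with `decide` values. [folklore] -/
theorem allIdxFn_decide {h c : List Bool → List Bool} (hc : OneBit c) {u : List Bool} (hu : (h u).length ≤ u.length)
    {P : ℕ → Prop} [DecidablePred P] (hP : ∀ i < (h u).length, c (boolPair u (ones i)) = [decide (P i)]) :
    allIdxFn h c u = [decide (∀ i < (h u).length, P i)] := by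
  rw [allIdxFn_apply hc hu]
  congr 1
  apply Bool.decide_congr
  refine forall₂_congr fun i hi => ?_
  rw [hP i hi]
  simp

/-! ### Records `⟨w, ⟨1ˣ, 1ʸ⟩⟩` and their projections -/

/-- The record of the input and two occurrence indices. [folklore] -/
def R (w : List Bool) (x y : ℕ) : List Bool := boolPair w (boolPair (ones x) (ones y))

/-- The input field of a record. [folklore] -/
def pW : List Bool → List Bool := fstF
/-- The first index field. [folklore] -/
def pX : List Bool → List Bool := fstF ∘ sndF
/-- The second index field. [folklore] -/
def pY : List Bool → List Bool := sndF ∘ sndF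
/-- On a scan argument `⟨R, 1ᵃ⟩`: the input field. [folklore] -/
def w1 : List Bool → List Bool := pW ∘ fstF
/-- On `⟨R, 1ᵃ⟩`: the first index field. [folklore] -/
def x1 : List Bool → List Bool := pX ∘ fstF
/-- On `⟨R, 1ᵃ⟩`: the second index field. [folklore] -/
def y1 : List Bool → List Bool := pY ∘ fstF
/-- On `⟨R, 1ᵃ⟩`: the scan index `1ᵃ`. [folklore] -/
def a1 : List Bool → List Bool := sndF
/-- Re-packing a record from three computed fields. [folklore] -/
def mkR (f g h : List Bool → List Bool) : List Bool → List Bool := fanoutFn f (fanoutFn g h)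

/-- `pW ∈ FP`. [cite: AroraBarakCC2009, §1.3] -/
theorem pW_mem_FP : pW ∈ FP := fstF_mem_FP
/-- `pX ∈ FP`. [cite: AroraBarakCC2009, §1.3] -/
theorem pX_mem_FP : pX ∈ FP := comp_mem_FP fstF_mem_FP sndF_mem_FP
/-- `pY ∈ FP`. [cite: AroraBarakCC2009, §1.3] -/
theorem pY_mem_FP : pY ∈ FP := comp_mem_FP sndF_mem_FP sndF_mem_FP
/-- `w1 ∈ FP`. [cite: AroraBarakCC2009, §1.3] -/
theorem w1_mem_FP : w1 ∈ FP := comp_mem_FP pW_mem_FP fstF_mem_FP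
/-- `x1 ∈ FP`. [cite: AroraBarakCC2009, §1.3] -/
theorem x1_mem_FP : x1 ∈ FP := comp_mem_FP pX_mem_FP fstF_mem_FP
/-- `y1 ∈ FP`. [cite: AroraBarakCC2009, §1.3] -/
theorem y1_mem_FP : y1 ∈ FP := comp_mem_FP pY_mem_FP fstF_mem_FP
/-- `a1 ∈ FP`. [cite: AroraBarakCC2009, §1.3] -/
theorem a1_mem_FP : a1 ∈ FP := sndF_mem_FP
/-- `mkR f g h ∈ FP`. [cite: AroraBarakCC2009, §1.3] -/
theorem mkR_mem_FP {f g h : List Bool → List Bool} (hf : f ∈ FP) (hg : g ∈ FP) (hh : h ∈ FP) : mkR f g h ∈ FP :=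
  fanoutFn_mem_FP hf (fanoutFn_mem_FP hg hh)

variable (w : List Bool) (x y a : ℕ)

/-- `pW_R`. [folklore] -/
@[simp] theorem pW_R : pW (R w x y) = w := by simp [pW, R]
/-- `pX_R`. [folklore] -/
@[simp] theorem pX_R : pX (R w x y) = ones x := by simp [pX, R]
/-- `pY_R`. [folklore] -/
@[simp] theorem pY_R : pY (R w x y) = ones y := by simp [pY, R]
/-- `w1_S`. [folklore] -/
@[simp] theorem w1_S : w1 (boolPair (R w x y) (ones a)) = w := by simp [w1]
/-- `x1_S`. [folklore] -/
@[simp] theorem x1_S : x1 (boolPair (R w x y) (ones a)) = ones x := by simp [x1]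
/-- `y1_S`. [folklore] -/
@[simp] theorem y1_S : y1 (boolPair (R w x y) (ones a)) = ones y := by simp [y1]
/-- `a1_S`. [folklore] -/
@[simp] theorem a1_S : a1 (boolPair (R w x y) (ones a)) = ones a := by simp [a1]

/-- Value of a re-packed record. [folklore] -/
theorem mkR_apply_of {f g h : List Bool → List Bool} {z w' : List Bool} {x' y' : ℕ} (hf : f z = w') (hg : g z = ones x')
    (hh : h z = ones y') : mkR f g h z = R w' x' y' := by
  simp [mkR, R, hf, hg, hh]

/-- The constant `1⁰` field. [folklore] -/
theorem zero_field (z : List Bool) : (fun _ : List Bool => ([] : List Bool)) z = ones 0 := rfl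

/-! ### The yardstick `1^{3m}` of the scans -/

/-- `t3F w = 1^{3 m}`, `m` the number of announced clauses. [folklore] -/
def t3F : List Bool → List Bool := onesFn ∘ appF ∘ fanoutFn fstF (appF ∘ fanoutFn fstF fstF)

/-- Value of `t3F`. [folklore] -/
@[simp] theorem t3F_apply (w : List Bool) : t3F w = ones (3 * mOf w) := by
  simp only [t3F, Function.comp_apply, fanoutFn_apply, appF_boolPair, onesFn_eq_ones, List.length_append, mOf]
  congr 1; ring

/-- `t3F ∈ FP`. [cite: AroraBarakCC2009, §1.3] -/
theorem t3F_mem_FP : t3F ∈ FP :=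
  comp_mem_FP onesFn_mem_FP (comp_mem_FP appF_mem_FP (fanoutFn_mem_FP fstF_mem_FP
    (comp_mem_FP appF_mem_FP (fanoutFn_mem_FP fstF_mem_FP fstF_mem_FP))))

/-- The yardstick of a scan over occurrences on a record: `1^{3m}` clipped to the length of the record
(so that it always fits; no clipping happens on genuine records). [folklore] -/
def hR : List Bool → List Bool := takeFn ∘ fanoutFn id (t3F ∘ pW)

/-- `hR ∈ FP`. [cite: AroraBarakCC2009, §1.3] -/
theorem hR_mem_FP : hR ∈ FP :=
  comp_mem_FP takeFn_mem_FP (fanoutFn_mem_FP OracleCompose.id_mem_FP (comp_mem_FP t3F_mem_FP pW_mem_FP))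

/-- The yardstick always fits. [folklore] -/
theorem length_hR_le (u : List Bool) : (hR u).length ≤ u.length := by
  simp only [hR, Function.comp_apply, fanoutFn_apply, id, takeFn_boolPair]
  exact (List.length_take_le _ _)

/-- A code is longer than thrice its number of clauses. [folklore] -/
theorem three_mul_length_le_length_encode (φ : CNF ℕ) : 3 * φ.length ≤ (encodingCNF.encode φ).length := by
  rw [encodeCNF_eq, length_boolPair, List.length_replicate]
  have : φ.length ≤ (encList (φ.map encodingClause.encode)).length := by
    have h := length_encList (φ.map encodingClause.encode)
    have : ∀ c ∈ φ.map encodingClause.encode, 1 ≤ c.length := fun c hc => by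
      obtain ⟨d, -, rfl⟩ := List.mem_map.1 hc
      rw [encodeClause_eq, length_boolPair]; omega
    have hsum : φ.length ≤ ((φ.map encodingClause.encode).map fun c => 2 * c.length + 2).sum := by
      have : ∀ l : List (List Bool), l.length ≤ (l.map fun c => 2 * c.length + 2).sum := by
        intro l; induction l with
        | nil => simp
        | cons c l ih => simp only [List.map_cons, List.sum_cons, List.length_cons]; omega
      simpa using this (φ.map encodingClause.encode)
    rw [h]; exact hsum
  omega

/-- On a record of a code, the yardstick is `1^{3m}`. [folklore] -/
theorem hR_R_encode (φ : CNF ℕ) (x y : ℕ) : hR (R (encodingCNF.encode φ) x y) = ones (3 * φ.length) := by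
  simp only [hR, Function.comp_apply, fanoutFn_apply, id, takeFn_boolPair, pW_R, t3F_apply, mOf_encode]
  rw [List.take_of_length_le]
  rw [List.length_replicate, R, length_boolPair]
  have := three_mul_length_le_length_encode φ
  omega

/-! ### The primitive tests: equal variables, order of unary indices -/

/-- On a record: `[var x = var y]` (the raw variable fields of the two occurrences are equal).
[cite: AroraBarakCC2009, Thm. 2.17 (proof)] -/
def veqF : List Bool → List Bool := eqPairFn ∘ fanoutFn (varF ∘ fanoutFn pW pX) (varF ∘ fanoutFn pW pY)

/-- `veqF ∈ FP`. [cite: AroraBarakCC2009, §1.3] -/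
theorem veqF_mem_FP : veqF ∈ FP :=
  comp_mem_FP eqPairFn_mem_FP (fanoutFn_mem_FP (comp_mem_FP varF_mem_FP (fanoutFn_mem_FP pW_mem_FP pX_mem_FP))
    (comp_mem_FP varF_mem_FP (fanoutFn_mem_FP pW_mem_FP pY_mem_FP)))

/-- `veqF` is one-bit. [folklore] -/
theorem oneBit_veqF : OneBit veqF := oneBit_eqPairFn.comp _

/-- On a record: `[x < y]`. [folklore] -/
def ltF : List Bool → List Bool := ltLenF ∘ fanoutFn pX pY

/-- `ltF ∈ FP`. [cite: AroraBarakCC2009, §1.3] -/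
theorem ltF_mem_FP : ltF ∈ FP := comp_mem_FP ltLenF_mem_FP (fanoutFn_mem_FP pX_mem_FP pY_mem_FP)

/-- `ltF` is one-bit. [folklore] -/
theorem oneBit_ltF : OneBit ltF := oneBit_ltLenF.comp _

/-- Value of `ltF`. [folklore] -/
@[simp] theorem ltF_R : ltF (R w x y) = [decide (x < y)] := by
  simp [ltF, ones]

section VeqValue

variable (φ : CNF ℕ) (hne : ∀ c ∈ φ, c ≠ [])
include hne

/-- The variable of occurrence `a` of `φ` (junk past `3 |φ|`). [folklore] -/
def V (a : ℕ) : ℕ := (slotLit (φ.getD (a / 3) []) (a % 3)).1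

/-- The polarity of occurrence `a` of `φ`. [folklore] -/
def Pb (a : ℕ) : Bool := (slotLit (φ.getD (a / 3) []) (a % 3)).2

omit hne in
/-- In range, `V` reads the clause by `getElem`. [folklore] -/
theorem V_eq {a : ℕ} (ha : a < 3 * φ.length) : V φ a = (slotLit φ[a / 3] (a % 3)).1 := by
  rw [V, List.getD_eq_getElem _ _ (div_three_lt_of_lt ha)]

omit hne in
/-- In range, `Pb` reads the clause by `getElem`. [folklore] -/
theorem Pb_eq {a : ℕ} (ha : a < 3 * φ.length) : Pb φ a = (slotLit φ[a / 3] (a % 3)).2 := by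
  rw [Pb, List.getD_eq_getElem _ _ (div_three_lt_of_lt ha)]

/-- **Value of `veqF` on a record of a code** (canonical numerals are equal iff the numbers are).
[folklore] -/
theorem veqF_R_encode {x y : ℕ} (hx : x < 3 * φ.length) (hy : y < 3 * φ.length) :
    veqF (R (encodingCNF.encode φ) x y) = [decide (V φ x = V φ y)] := by
  simp only [veqF, Function.comp_apply, fanoutFn_apply, pW_R, pX_R, pY_R, varF_encode φ hne hx, varF_encode φ hne hy,
    eqPairFn_boolPair, V_eq φ hx, V_eq φ hy]
  congr 1
  exact Bool.decide_congr encodeNat_inj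

/-- Value of `polF` through a record of a code. [folklore] -/
theorem polF_R_encode {x y : ℕ} (hx : x < 3 * φ.length) :
    polF (fanoutFn pW pX (R (encodingCNF.encode φ) x y)) = [Pb φ x] := by
  rw [fanoutFn_apply, pW_R, pX_R, polF_encode φ hne hx, Pb_eq φ hx]

end VeqValue

/-! ### The scans: first, last and next occurrence, the order of first occurrences -/

section Scans

/-- `[|f z| < |g z|]`. [folklore] -/
def ltOf (f g : List Bool → List Bool) : List Bool → List Bool := ltLenF ∘ fanoutFn f g

/-- `ltOf f g ∈ FP`. [cite: AroraBarakCC2009, §1.3] -/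
theorem ltOf_mem_FP {f g : List Bool → List Bool} (hf : f ∈ FP) (hg : g ∈ FP) : ltOf f g ∈ FP :=
  comp_mem_FP ltLenF_mem_FP (fanoutFn_mem_FP hf hg)

/-- `ltOf f g` is one-bit. [folklore] -/
theorem oneBit_ltOf (f g : List Bool → List Bool) : OneBit (ltOf f g) := oneBit_ltLenF.comp _

/-- Value of `ltOf` from the values of the fields. [folklore] -/
theorem ltOf_apply_of {f g : List Bool → List Bool} {z : List Bool} {p q : ℕ} (hf : f z = ones p) (hg : g z = ones q) :
    ltOf f g z = [decide (p < q)] := by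
  simp [ltOf, hf, hg, ones]

/-- `[var (g z) = var (h z)]` in the input `f z`. [folklore] -/
def veqOf (f g h : List Bool → List Bool) : List Bool → List Bool := veqF ∘ mkR f g h

/-- `veqOf f g h ∈ FP`. [cite: AroraBarakCC2009, §1.3] -/
theorem veqOf_mem_FP {f g h : List Bool → List Bool} (hf : f ∈ FP) (hg : g ∈ FP) (hh : h ∈ FP) : veqOf f g h ∈ FP :=
  comp_mem_FP veqF_mem_FP (mkR_mem_FP hf hg hh)

/-- `veqOf` is one-bit. [folklore] -/
theorem oneBit_veqOf (f g h : List Bool → List Bool) : OneBit (veqOf f g h) := oneBit_veqF.comp _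

/-! The mirrored predicates on occurrence indices below `T`, for a variable map `V`. -/

/-- `x` is the first occurrence of its variable. [folklore] -/
def qFirst (T : ℕ) (V : ℕ → ℕ) (x : ℕ) : Prop := ∀ a < T, a < x → V a ≠ V x
/-- `x` is the last occurrence of its variable. [folklore] -/
def qLast (T : ℕ) (V : ℕ → ℕ) (x : ℕ) : Prop := ∀ a < T, x < a → V a ≠ V x
/-- `y` is the next occurrence of the variable of `x`. [folklore] -/
def qNext (T : ℕ) (V : ℕ → ℕ) (x y : ℕ) : Prop := V x = V y ∧ x < y ∧ ∀ a < T, x < a → a < y → V a ≠ V x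
/-- Some occurrence of the variable of `x` lies before `c`. [folklore] -/
def qExB (T : ℕ) (V : ℕ → ℕ) (x c : ℕ) : Prop := ∃ a < T, a < c ∧ V a = V x
/-- No occurrence of the variable of `y` lies at or before `c`. [folklore] -/
def qAllNA (T : ℕ) (V : ℕ → ℕ) (y c : ℕ) : Prop := ∀ b < T, ¬c < b → V b ≠ V y
/-- The first occurrence of the variable of `x` precedes that of the variable of `y`. [folklore] -/
def qBefore (T : ℕ) (V : ℕ → ℕ) (x y : ℕ) : Prop := ∃ a < T, V a = V x ∧ qAllNA T V y a
/-- No first occurrence lies strictly between those of the variables of `x` and `y`. [folklore] -/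
def qNFB (T : ℕ) (V : ℕ → ℕ) (x y : ℕ) : Prop := ∀ c < T, ¬(qFirst T V c ∧ qExB T V x c ∧ qAllNA T V y c)
/-- No first occurrence lies after that of the variable of `x`. [folklore] -/
def qLastFirst (T : ℕ) (V : ℕ → ℕ) (x : ℕ) : Prop := ∀ c < T, qFirst T V c → ¬qExB T V x c

/-- Decidability (bounded quantifiers and case distinctions). [folklore] -/
instance (T : ℕ) (V : ℕ → ℕ) (x : ℕ) : Decidable (qFirst T V x) := by unfold qFirst; infer_instance
/-- Decidability (bounded quantifiers and case distinctions). [folklore] -/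
instance (T : ℕ) (V : ℕ → ℕ) (x : ℕ) : Decidable (qLast T V x) := by unfold qLast; infer_instance
/-- Decidability (bounded quantifiers and case distinctions). [folklore] -/
instance (T : ℕ) (V : ℕ → ℕ) (x y : ℕ) : Decidable (qNext T V x y) := by unfold qNext; infer_instance
/-- Decidability (bounded quantifiers and case distinctions). [folklore] -/
instance (T : ℕ) (V : ℕ → ℕ) (x c : ℕ) : Decidable (qExB T V x c) := by unfold qExB; infer_instance
/-- Decidability (bounded quantifiers and case distinctions). [folklore] -/
instance (T : ℕ) (V : ℕ → ℕ) (y c : ℕ) : Decidable (qAllNA T V y c) := by unfold qAllNA; infer_instance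
/-- Decidability (bounded quantifiers and case distinctions). [folklore] -/
instance (T : ℕ) (V : ℕ → ℕ) (x y : ℕ) : Decidable (qBefore T V x y) := by unfold qBefore; infer_instance
/-- Decidability (bounded quantifiers and case distinctions). [folklore] -/
instance (T : ℕ) (V : ℕ → ℕ) (x y : ℕ) : Decidable (qNFB T V x y) := by unfold qNFB; infer_instance
/-- Decidability (bounded quantifiers and case distinctions). [folklore] -/
instance (T : ℕ) (V : ℕ → ℕ) (x : ℕ) : Decidable (qLastFirst T V x) := by unfold qLastFirst; infer_instance

/-! The bricks. -/

/-- Body of `firstF`: `[a < x → var a ≠ var x]`. [folklore] -/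
def firstBody : List Bool → List Bool := orFn (notFn (ltOf a1 x1)) (notFn (veqOf w1 a1 x1))
/-- **`[x is a first occurrence]`**. [cite: AroraBarakCC2009, Thm. 2.17 (proof: the chains)] -/
def firstF : List Bool → List Bool := allIdxFn hR firstBody
/-- Body of `lastF`: `[x < a → var a ≠ var x]`. [folklore] -/
def lastBody : List Bool → List Bool := orFn (notFn (ltOf x1 a1)) (notFn (veqOf w1 a1 x1))
/-- **`[x is a last occurrence]`**. [cite: AroraBarakCC2009, Thm. 2.17 (proof: the chains)] -/
def lastF : List Bool → List Bool := allIdxFn hR lastBody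
/-- Body of the scan of `nextF`: `[x < a → a < y → var a ≠ var x]`. [folklore] -/
def nextBody : List Bool → List Bool :=
  orFn (notFn (ltOf x1 a1)) (orFn (notFn (ltOf a1 y1)) (notFn (veqOf w1 a1 x1)))
/-- **`[y is the next occurrence of the variable of x]`**. [cite: AroraBarakCC2009, Thm. 2.17 (proof: the chains)] -/
def nextF : List Bool → List Bool := andFn veqF (andFn ltF (allIdxFn hR nextBody))
/-- Body of `exbF`: `[a < c ∧ var a = var x]` (on `R(w, x, c)`). [folklore] -/
def exbBody : List Bool → List Bool := andFn (ltOf a1 y1) (veqOf w1 a1 x1)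
/-- `[∃ a < c with var a = var x]` (on `R(w, x, c)`). [folklore] -/
def exbF : List Bool → List Bool := notFn (allIdxFn hR (notFn exbBody))
/-- Body of `allnaF`: `[c < b ∨ var b ≠ var y]` (on `R(w, y, c)`). [folklore] -/
def allnaBody : List Bool → List Bool := orFn (ltOf y1 a1) (notFn (veqOf w1 a1 x1))
/-- `[∀ b ≤ c, var b ≠ var y]` (on `R(w, y, c)`). [folklore] -/
def allnaF : List Bool → List Bool := allIdxFn hR allnaBody
/-- Body of `beforeF`: `[var a = var x ∧ ∀ b ≤ a, var b ≠ var y]`. [folklore] -/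
def beforeBody : List Bool → List Bool := andFn (veqOf w1 a1 x1) (allnaF ∘ mkR w1 y1 a1)
/-- **`[the chain of x precedes the chain of y]`**. [cite: AroraBarakCC2009, Thm. 2.17 (proof: "edges from the extreme points of the jth chain to the extreme points of the (j+1)th chain")] -/
def beforeF : List Bool → List Bool := notFn (allIdxFn hR (notFn beforeBody))
/-- Body of `nfbF`: `¬(c first ∧ the chain of x precedes c ∧ c precedes the chain of y)`. [folklore] -/
def nfbBody : List Bool → List Bool :=
  notFn (andFn (firstF ∘ mkR w1 a1 fun _ => []) (andFn (exbF ∘ mkR w1 x1 a1) (allnaF ∘ mkR w1 y1 a1)))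
/-- **`[no chain lies strictly between the chains of x and y]`**. [cite: AroraBarakCC2009, Thm. 2.17 (proof)] -/
def nfbF : List Bool → List Bool := allIdxFn hR nfbBody
/-- Body of `lastFirstF`: `[c first → ¬ the chain of x precedes c]`. [folklore] -/
def lfBody : List Bool → List Bool := orFn (notFn (firstF ∘ mkR w1 a1 fun _ => [])) (notFn (exbF ∘ mkR w1 x1 a1))
/-- **`[the chain of x is the last chain]`**. [cite: AroraBarakCC2009, Thm. 2.17 (proof)] -/
def lastFirstF : List Bool → List Bool := allIdxFn hR lfBody

/-! Membership in `FP` and one-bit outputs. -/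

/-- `firstBody` is one-bit. [folklore] -/
theorem oneBit_firstBody : OneBit firstBody := oneBit_orFn (oneBit_notFn (oneBit_ltOf _ _)) (oneBit_notFn (oneBit_veqOf _ _ _))
/-- `firstBody ∈ FP`. [cite: AroraBarakCC2009, §1.3] -/
theorem firstBody_mem_FP : firstBody ∈ FP :=
  orFn_mem_FP (notFn_mem_FP (ltOf_mem_FP a1_mem_FP x1_mem_FP)) (notFn_mem_FP (veqOf_mem_FP w1_mem_FP a1_mem_FP x1_mem_FP))
/-- `firstF ∈ FP`. [cite: AroraBarakCC2009, §1.3] -/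
theorem firstF_mem_FP : firstF ∈ FP := allIdxFn_mem_FP hR_mem_FP firstBody_mem_FP oneBit_firstBody
/-- `firstF` is one-bit. [folklore] -/
theorem oneBit_firstF : OneBit firstF := oneBit_allIdxFn oneBit_firstBody length_hR_le

/-- `lastBody` is one-bit. [folklore] -/
theorem oneBit_lastBody : OneBit lastBody := oneBit_orFn (oneBit_notFn (oneBit_ltOf _ _)) (oneBit_notFn (oneBit_veqOf _ _ _))
/-- `lastBody ∈ FP`. [cite: AroraBarakCC2009, §1.3] -/
theorem lastBody_mem_FP : lastBody ∈ FP :=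
  orFn_mem_FP (notFn_mem_FP (ltOf_mem_FP x1_mem_FP a1_mem_FP)) (notFn_mem_FP (veqOf_mem_FP w1_mem_FP a1_mem_FP x1_mem_FP))
/-- `lastF ∈ FP`. [cite: AroraBarakCC2009, §1.3] -/
theorem lastF_mem_FP : lastF ∈ FP := allIdxFn_mem_FP hR_mem_FP lastBody_mem_FP oneBit_lastBody
/-- `lastF` is one-bit. [folklore] -/
theorem oneBit_lastF : OneBit lastF := oneBit_allIdxFn oneBit_lastBody length_hR_le

/-- `nextBody` is one-bit. [folklore] -/
theorem oneBit_nextBody : OneBit nextBody :=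
  oneBit_orFn (oneBit_notFn (oneBit_ltOf _ _)) (oneBit_orFn (oneBit_notFn (oneBit_ltOf _ _)) (oneBit_notFn (oneBit_veqOf _ _ _)))
/-- `nextBody ∈ FP`. [cite: AroraBarakCC2009, §1.3] -/
theorem nextBody_mem_FP : nextBody ∈ FP :=
  orFn_mem_FP (notFn_mem_FP (ltOf_mem_FP x1_mem_FP a1_mem_FP)) (orFn_mem_FP (notFn_mem_FP (ltOf_mem_FP a1_mem_FP y1_mem_FP))
    (notFn_mem_FP (veqOf_mem_FP w1_mem_FP a1_mem_FP x1_mem_FP)))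
/-- `nextF ∈ FP`. [cite: AroraBarakCC2009, §1.3] -/
theorem nextF_mem_FP : nextF ∈ FP :=
  andFn_mem_FP veqF_mem_FP (andFn_mem_FP ltF_mem_FP (allIdxFn_mem_FP hR_mem_FP nextBody_mem_FP oneBit_nextBody))
/-- `nextF` is one-bit. [folklore] -/
theorem oneBit_nextF : OneBit nextF :=
  oneBit_andFn oneBit_veqF (oneBit_andFn oneBit_ltF (oneBit_allIdxFn oneBit_nextBody length_hR_le))

/-- `exbBody` is one-bit. [folklore] -/
theorem oneBit_exbBody : OneBit exbBody := oneBit_andFn (oneBit_ltOf _ _) (oneBit_veqOf _ _ _)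
/-- `exbBody ∈ FP`. [cite: AroraBarakCC2009, §1.3] -/
theorem exbBody_mem_FP : exbBody ∈ FP := andFn_mem_FP (ltOf_mem_FP a1_mem_FP y1_mem_FP) (veqOf_mem_FP w1_mem_FP a1_mem_FP x1_mem_FP)
/-- `exbF ∈ FP`. [cite: AroraBarakCC2009, §1.3] -/
theorem exbF_mem_FP : exbF ∈ FP :=
  notFn_mem_FP (allIdxFn_mem_FP hR_mem_FP (notFn_mem_FP exbBody_mem_FP) (oneBit_notFn oneBit_exbBody))
/-- `exbF` is one-bit. [folklore] -/
theorem oneBit_exbF : OneBit exbF := oneBit_notFn (oneBit_allIdxFn (oneBit_notFn oneBit_exbBody) length_hR_le)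

/-- `allnaBody` is one-bit. [folklore] -/
theorem oneBit_allnaBody : OneBit allnaBody := oneBit_orFn (oneBit_ltOf _ _) (oneBit_notFn (oneBit_veqOf _ _ _))
/-- `allnaBody ∈ FP`. [cite: AroraBarakCC2009, §1.3] -/
theorem allnaBody_mem_FP : allnaBody ∈ FP :=
  orFn_mem_FP (ltOf_mem_FP y1_mem_FP a1_mem_FP) (notFn_mem_FP (veqOf_mem_FP w1_mem_FP a1_mem_FP x1_mem_FP))
/-- `allnaF ∈ FP`. [cite: AroraBarakCC2009, §1.3] -/
theorem allnaF_mem_FP : allnaF ∈ FP := allIdxFn_mem_FP hR_mem_FP allnaBody_mem_FP oneBit_allnaBody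
/-- `allnaF` is one-bit. [folklore] -/
theorem oneBit_allnaF : OneBit allnaF := oneBit_allIdxFn oneBit_allnaBody length_hR_le

/-- `beforeBody` is one-bit. [folklore] -/
theorem oneBit_beforeBody : OneBit beforeBody := oneBit_andFn (oneBit_veqOf _ _ _) (oneBit_allnaF.comp _)
/-- `beforeBody ∈ FP`. [cite: AroraBarakCC2009, §1.3] -/
theorem beforeBody_mem_FP : beforeBody ∈ FP :=
  andFn_mem_FP (veqOf_mem_FP w1_mem_FP a1_mem_FP x1_mem_FP) (comp_mem_FP allnaF_mem_FP (mkR_mem_FP w1_mem_FP y1_mem_FP a1_mem_FP))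
/-- `beforeF ∈ FP`. [cite: AroraBarakCC2009, §1.3] -/
theorem beforeF_mem_FP : beforeF ∈ FP :=
  notFn_mem_FP (allIdxFn_mem_FP hR_mem_FP (notFn_mem_FP beforeBody_mem_FP) (oneBit_notFn oneBit_beforeBody))
/-- `beforeF` is one-bit. [folklore] -/
theorem oneBit_beforeF : OneBit beforeF := oneBit_notFn (oneBit_allIdxFn (oneBit_notFn oneBit_beforeBody) length_hR_le)

/-- `nfbBody` is one-bit. [folklore] -/
theorem oneBit_nfbBody : OneBit nfbBody :=
  oneBit_notFn (oneBit_andFn (oneBit_firstF.comp _) (oneBit_andFn (oneBit_exbF.comp _) (oneBit_allnaF.comp _)))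
/-- `nfbBody ∈ FP`. [cite: AroraBarakCC2009, §1.3] -/
theorem nfbBody_mem_FP : nfbBody ∈ FP :=
  notFn_mem_FP (andFn_mem_FP (comp_mem_FP firstF_mem_FP (mkR_mem_FP w1_mem_FP a1_mem_FP (const_mem_FP _)))
    (andFn_mem_FP (comp_mem_FP exbF_mem_FP (mkR_mem_FP w1_mem_FP x1_mem_FP a1_mem_FP))
      (comp_mem_FP allnaF_mem_FP (mkR_mem_FP w1_mem_FP y1_mem_FP a1_mem_FP))))
/-- `nfbF ∈ FP`. [cite: AroraBarakCC2009, §1.3] -/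
theorem nfbF_mem_FP : nfbF ∈ FP := allIdxFn_mem_FP hR_mem_FP nfbBody_mem_FP oneBit_nfbBody
/-- `nfbF` is one-bit. [folklore] -/
theorem oneBit_nfbF : OneBit nfbF := oneBit_allIdxFn oneBit_nfbBody length_hR_le

/-- `lfBody` is one-bit. [folklore] -/
theorem oneBit_lfBody : OneBit lfBody := oneBit_orFn (oneBit_notFn (oneBit_firstF.comp _)) (oneBit_notFn (oneBit_exbF.comp _))
/-- `lfBody ∈ FP`. [cite: AroraBarakCC2009, §1.3] -/
theorem lfBody_mem_FP : lfBody ∈ FP :=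
  orFn_mem_FP (notFn_mem_FP (comp_mem_FP firstF_mem_FP (mkR_mem_FP w1_mem_FP a1_mem_FP (const_mem_FP _))))
    (notFn_mem_FP (comp_mem_FP exbF_mem_FP (mkR_mem_FP w1_mem_FP x1_mem_FP a1_mem_FP)))
/-- `lastFirstF ∈ FP`. [cite: AroraBarakCC2009, §1.3] -/
theorem lastFirstF_mem_FP : lastFirstF ∈ FP := allIdxFn_mem_FP hR_mem_FP lfBody_mem_FP oneBit_lfBody
/-- `lastFirstF` is one-bit. [folklore] -/
theorem oneBit_lastFirstF : OneBit lastFirstF := oneBit_allIdxFn oneBit_lfBody length_hR_le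

/-! Values on a record of a code. -/

variable (φ : CNF ℕ) (hne : ∀ c ∈ φ, c ≠ [])
include hne

omit hne in
/-- Length of the yardstick on a record of a code. [folklore] -/
theorem length_hR_R_encode (x y : ℕ) : (hR (R (encodingCNF.encode φ) x y)).length = 3 * φ.length := by
  rw [hR_R_encode]; simp [ones]

omit hne in
/-- A re-packed record on a scan argument of a code record. [folklore] -/
theorem veqOf_S {f g h : List Bool → List Bool} {x y a x' y' : ℕ}
    (hf : f (boolPair (R (encodingCNF.encode φ) x y) (ones a)) = encodingCNF.encode φ)
    (hg : g (boolPair (R (encodingCNF.encode φ) x y) (ones a)) = ones x')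
    (hh : h (boolPair (R (encodingCNF.encode φ) x y) (ones a)) = ones y')
    (hne : ∀ c ∈ φ, c ≠ []) (hx' : x' < 3 * φ.length) (hy' : y' < 3 * φ.length) :
    veqOf f g h (boolPair (R (encodingCNF.encode φ) x y) (ones a)) = [decide (V φ x' = V φ y')] := by
  rw [veqOf, Function.comp_apply, mkR_apply_of hf hg hh, veqF_R_encode φ hne hx' hy']

/-- **Value of `firstF`.** [folklore] -/
theorem firstF_R_encode {x : ℕ} (y : ℕ) (hx : x < 3 * φ.length) :
    firstF (R (encodingCNF.encode φ) x y) = [decide (qFirst (3 * φ.length) (V φ) x)] := by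
  rw [firstF, allIdxFn_decide oneBit_firstBody (length_hR_le _) (P := fun a => ¬a < x ∨ ¬V φ a = V φ x),
    length_hR_R_encode φ]
  · congr 1
    apply Bool.decide_congr
    simp only [qFirst, imp_iff_not_or]
  · intro i hi
    rw [length_hR_R_encode φ] at hi
    exact orFn_decide (notFn_decide (ltOf_apply_of (a1_S _ _ _ _) (x1_S _ _ _ _)))
      (notFn_decide (veqOf_S φ (w1_S _ _ _ _) (a1_S _ _ _ _) (x1_S _ _ _ _) hne hi hx))

/-- **Value of `lastF`.** [folklore] -/
theorem lastF_R_encode {x : ℕ} (y : ℕ) (hx : x < 3 * φ.length) :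
    lastF (R (encodingCNF.encode φ) x y) = [decide (qLast (3 * φ.length) (V φ) x)] := by
  rw [lastF, allIdxFn_decide oneBit_lastBody (length_hR_le _) (P := fun a => ¬x < a ∨ ¬V φ a = V φ x),
    length_hR_R_encode φ]
  · congr 1
    apply Bool.decide_congr
    simp only [qLast, imp_iff_not_or]
  · intro i hi
    rw [length_hR_R_encode φ] at hi
    exact orFn_decide (notFn_decide (ltOf_apply_of (x1_S _ _ _ _) (a1_S _ _ _ _)))
      (notFn_decide (veqOf_S φ (w1_S _ _ _ _) (a1_S _ _ _ _) (x1_S _ _ _ _) hne hi hx))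

/-- **Value of `nextF`.** [folklore] -/
theorem nextF_R_encode {x y : ℕ} (hx : x < 3 * φ.length) (hy : y < 3 * φ.length) :
    nextF (R (encodingCNF.encode φ) x y) = [decide (qNext (3 * φ.length) (V φ) x y)] := by
  have hscan : allIdxFn hR nextBody (R (encodingCNF.encode φ) x y) =
      [decide (∀ a < 3 * φ.length, ¬x < a ∨ (¬a < y ∨ ¬V φ a = V φ x))] := by
    rw [allIdxFn_decide oneBit_nextBody (length_hR_le _) (P := fun a => ¬x < a ∨ (¬a < y ∨ ¬V φ a = V φ x)),
      length_hR_R_encode φ]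
    intro i hi
    rw [length_hR_R_encode φ] at hi
    exact orFn_decide (notFn_decide (ltOf_apply_of (x1_S _ _ _ _) (a1_S _ _ _ _)))
      (orFn_decide (notFn_decide (ltOf_apply_of (a1_S _ _ _ _) (y1_S _ _ _ _)))
        (notFn_decide (veqOf_S φ (w1_S _ _ _ _) (a1_S _ _ _ _) (x1_S _ _ _ _) hne hi hx)))
  rw [nextF, andFn_decide (veqF_R_encode φ hne hx hy) (andFn_decide (ltF_R _ _ _) hscan)]
  congr 1
  apply Bool.decide_congr
  simp only [qNext, imp_iff_not_or]

/-- Value of `exbF` (on `R(w, x, c)`). [folklore] -/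
theorem exbF_R_encode {x : ℕ} (c : ℕ) (hx : x < 3 * φ.length) :
    exbF (R (encodingCNF.encode φ) x c) = [decide (qExB (3 * φ.length) (V φ) x c)] := by
  have hscan : allIdxFn hR (notFn exbBody) (R (encodingCNF.encode φ) x c) =
      [decide (∀ a < 3 * φ.length, ¬(a < c ∧ V φ a = V φ x))] := by
    rw [allIdxFn_decide (oneBit_notFn oneBit_exbBody) (length_hR_le _) (P := fun a => ¬(a < c ∧ V φ a = V φ x)),
      length_hR_R_encode φ]
    intro i hi
    rw [length_hR_R_encode φ] at hi
    exact notFn_decide (andFn_decide (ltOf_apply_of (a1_S _ _ _ _) (y1_S _ _ _ _))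
      (veqOf_S φ (w1_S _ _ _ _) (a1_S _ _ _ _) (x1_S _ _ _ _) hne hi hx))
  rw [exbF, notFn_decide hscan]
  congr 1
  apply Bool.decide_congr
  simp only [qExB, not_forall, not_not, exists_prop]

/-- Value of `allnaF` (on `R(w, y, c)`). [folklore] -/
theorem allnaF_R_encode {y : ℕ} (c : ℕ) (hy : y < 3 * φ.length) :
    allnaF (R (encodingCNF.encode φ) y c) = [decide (qAllNA (3 * φ.length) (V φ) y c)] := by
  rw [allnaF, allIdxFn_decide oneBit_allnaBody (length_hR_le _) (P := fun b => c < b ∨ ¬V φ b = V φ y),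
    length_hR_R_encode φ]
  · congr 1
    apply Bool.decide_congr
    simp only [qAllNA, imp_iff_not_or, not_not]
  · intro i hi
    rw [length_hR_R_encode φ] at hi
    exact orFn_decide (ltOf_apply_of (y1_S _ _ _ _) (a1_S _ _ _ _))
      (notFn_decide (veqOf_S φ (w1_S _ _ _ _) (a1_S _ _ _ _) (x1_S _ _ _ _) hne hi hy))

/-- **Value of `beforeF`.** [folklore] -/
theorem beforeF_R_encode {x y : ℕ} (hx : x < 3 * φ.length) (hy : y < 3 * φ.length) :
    beforeF (R (encodingCNF.encode φ) x y) = [decide (qBefore (3 * φ.length) (V φ) x y)] := by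
  have hscan : allIdxFn hR (notFn beforeBody) (R (encodingCNF.encode φ) x y) =
      [decide (∀ a < 3 * φ.length, ¬(V φ a = V φ x ∧ qAllNA (3 * φ.length) (V φ) y a))] := by
    rw [allIdxFn_decide (oneBit_notFn oneBit_beforeBody) (length_hR_le _)
      (P := fun a => ¬(V φ a = V φ x ∧ qAllNA (3 * φ.length) (V φ) y a)), length_hR_R_encode φ]
    intro i hi
    rw [length_hR_R_encode φ] at hi
    refine notFn_decide (andFn_decide (veqOf_S φ (w1_S _ _ _ _) (a1_S _ _ _ _) (x1_S _ _ _ _) hne hi hx) ?_)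
    rw [Function.comp_apply, mkR_apply_of (w1_S _ _ _ _) (y1_S _ _ _ _) (a1_S _ _ _ _), allnaF_R_encode φ hne _ hy]
  rw [beforeF, notFn_decide hscan]
  congr 1
  apply Bool.decide_congr
  simp only [qBefore, not_forall, not_not, exists_prop]

/-- **Value of `nfbF`.** [folklore] -/
theorem nfbF_R_encode {x y : ℕ} (hx : x < 3 * φ.length) (hy : y < 3 * φ.length) :
    nfbF (R (encodingCNF.encode φ) x y) = [decide (qNFB (3 * φ.length) (V φ) x y)] := by
  rw [nfbF, allIdxFn_decide oneBit_nfbBody (length_hR_le _)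
    (P := fun c => ¬(qFirst (3 * φ.length) (V φ) c ∧ qExB (3 * φ.length) (V φ) x c ∧ qAllNA (3 * φ.length) (V φ) y c)),
    length_hR_R_encode φ]
  · rfl
  · intro i hi
    rw [length_hR_R_encode φ] at hi
    refine notFn_decide (andFn_decide ?_ (andFn_decide ?_ ?_))
    · rw [Function.comp_apply, mkR_apply_of (w1_S _ _ _ _) (a1_S _ _ _ _) (zero_field (boolPair (R (encodingCNF.encode φ) x y) (ones i))),
        firstF_R_encode φ hne _ hi]
    · rw [Function.comp_apply, mkR_apply_of (w1_S _ _ _ _) (x1_S _ _ _ _) (a1_S _ _ _ _), exbF_R_encode φ hne _ hx]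
    · rw [Function.comp_apply, mkR_apply_of (w1_S _ _ _ _) (y1_S _ _ _ _) (a1_S _ _ _ _), allnaF_R_encode φ hne _ hy]

/-- **Value of `lastFirstF`.** [folklore] -/
theorem lastFirstF_R_encode {x : ℕ} (y : ℕ) (hx : x < 3 * φ.length) :
    lastFirstF (R (encodingCNF.encode φ) x y) = [decide (qLastFirst (3 * φ.length) (V φ) x)] := by
  rw [lastFirstF, allIdxFn_decide oneBit_lfBody (length_hR_le _)
    (P := fun c => ¬qFirst (3 * φ.length) (V φ) c ∨ ¬qExB (3 * φ.length) (V φ) x c), length_hR_R_encode φ]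
  · congr 1
    apply Bool.decide_congr
    simp only [qLastFirst, imp_iff_not_or]
  · intro i hi
    rw [length_hR_R_encode φ] at hi
    refine orFn_decide (notFn_decide ?_) (notFn_decide ?_)
    · rw [Function.comp_apply, mkR_apply_of (w1_S _ _ _ _) (a1_S _ _ _ _) (zero_field (boolPair (R (encodingCNF.encode φ) x y) (ones i))),
        firstF_R_encode φ hne _ hi]
    · rw [Function.comp_apply, mkR_apply_of (w1_S _ _ _ _) (x1_S _ _ _ _) (a1_S _ _ _ _), exbF_R_encode φ hne _ hx]

end Scans

/-! ### From indices to occurrences: the slot-CNF of a 3-CNF and the mirrored predicates -/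

section Bridge

open SatDHam

variable (φ : CNF ℕ)

/-- The slot-CNF of `φ`: clause `j`, slot `i ↦ slotLit φ[j] i`. [cite: AroraBarakCC2009, Thm. 2.17 (proof)] -/
def L (j : Fin φ.length) (i : Fin 3) : ℕ × Bool := slotLit φ[j] i

/-- The occurrence at reading position `a < 3 m`. [folklore] -/
def ofFlat {m : ℕ} (a : ℕ) (ha : a < 3 * m) : Occ m := (⟨a / 3, by omega⟩, ⟨a % 3, Nat.mod_lt _ (by norm_num)⟩)

/-- `flat (ofFlat a) = a`. [folklore] -/
@[simp] theorem flat_ofFlat {m : ℕ} (a : ℕ) (ha : a < 3 * m) : flat (ofFlat a ha) = a := by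
  simp only [flat, ofFlat]; omega

/-- `ofFlat (flat t) = t`. [folklore] -/
@[simp] theorem ofFlat_flat {m : ℕ} (t : Occ m) (h : flat t < 3 * m := by have := t.1.2; have := t.2.2; simp [flat]; omega) :
    ofFlat (flat t) h = t := by
  obtain ⟨j, i⟩ := t
  have hi := i.2
  simp only [ofFlat, flat, Prod.mk.injEq, Fin.ext_iff]
  omega

/-- Reading positions are below `3 m`. [folklore] -/
theorem flat_lt {m : ℕ} (t : Occ m) : flat t < 3 * m := by
  have := t.1.2; have := t.2.2; simp only [flat]; omega

/-- The variable of an occurrence is `V` at its reading position. [folklore] -/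
theorem var_L (t : Occ φ.length) : var (L φ) t = V φ (flat t) := by
  rw [V_eq φ (flat_lt t)]
  obtain ⟨j, i⟩ := t
  have hi := i.2
  have h1 : (3 * (j : ℕ) + i) / 3 = j := by omega
  have h2 : (3 * (j : ℕ) + i) % 3 = i := by omega
  simp only [var, L, flat, h1, h2, Fin.getElem_fin]

/-- The polarity of an occurrence is `Pb` at its reading position. [folklore] -/
theorem pol_L (t : Occ φ.length) : pol (L φ) t = Pb φ (flat t) := by
  rw [Pb_eq φ (flat_lt t)]
  obtain ⟨j, i⟩ := t
  have hi := i.2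
  have h1 : (3 * (j : ℕ) + i) / 3 = j := by omega
  have h2 : (3 * (j : ℕ) + i) % 3 = i := by omega
  simp only [pol, L, flat, h1, h2, Fin.getElem_fin]

/-- A bounded quantifier over reading positions is a quantifier over occurrences. [folklore] -/
theorem forall_flat_iff {m : ℕ} {P : ℕ → Prop} : (∀ a < 3 * m, P a) ↔ ∀ t : Occ m, P (flat t) :=
  ⟨fun h t => h _ (flat_lt t), fun h a ha => by simpa using h (ofFlat a ha)⟩

/-- A bounded existential over reading positions is an existential over occurrences. [folklore] -/
theorem exists_flat_iff {m : ℕ} {P : ℕ → Prop} : (∃ a < 3 * m, P a) ↔ ∃ t : Occ m, P (flat t) :=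
  ⟨fun ⟨a, ha, h⟩ => ⟨ofFlat a ha, by simpa using h⟩, fun ⟨t, h⟩ => ⟨_, flat_lt t, h⟩⟩

/-- **First occurrences, mirrored.** [folklore] -/
theorem isFirst_iff (t : Occ φ.length) : IsFirst (L φ) t ↔ qFirst (3 * φ.length) (V φ) (flat t) := by
  simp only [IsFirst, qFirst, var_L, forall_flat_iff (m := φ.length)]
  refine forall_congr' fun t' => ⟨fun h hlt heq => absurd (h heq) (by omega), fun h heq => ?_⟩
  by_contra hlt
  exact h (by omega) heq

/-- **Last occurrences, mirrored.** [folklore] -/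
theorem isLast_iff (t : Occ φ.length) : IsLast (L φ) t ↔ qLast (3 * φ.length) (V φ) (flat t) := by
  simp only [IsLast, qLast, var_L, forall_flat_iff (m := φ.length)]
  refine forall_congr' fun t' => ⟨fun h hlt heq => absurd (h heq) (by omega), fun h heq => ?_⟩
  by_contra hlt
  exact h (by omega) heq

/-- **Next occurrences, mirrored.** [folklore] -/
theorem isNextOcc_iff (t t' : Occ φ.length) :
    IsNextOcc (L φ) t t' ↔ qNext (3 * φ.length) (V φ) (flat t) (flat t') := by
  simp only [IsNextOcc, qNext, var_L, forall_flat_iff (m := φ.length)]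
  constructor
  · rintro ⟨hv, hlt, h⟩
    exact ⟨hv.symm, hlt, fun t'' h1 h2 heq => absurd (h t'' heq h1) (by omega)⟩
  · rintro ⟨hv, hlt, h⟩
    refine ⟨hv.symm, hlt, fun t'' heq h1 => ?_⟩
    by_contra h2
    exact h t'' h1 (by omega) heq

/-- The end condition, mirrored: `λ` of a first occurrence or `ρ` of a last occurrence. [folklore] -/
def qEnd (T : ℕ) (W : ℕ → ℕ) (t : ℕ) (s : ℕ) : Prop := (s = 0 ∧ qFirst T W t) ∨ (s = 5 ∧ qLast T W t)

/-- Decidability (bounded quantifiers and case distinctions). [folklore] -/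
instance (T : ℕ) (W : ℕ → ℕ) (t s : ℕ) : Decidable (qEnd T W t s) := by unfold qEnd; infer_instance

variable {φ}

/-- An end of the chain of `f` is an end of the chain of the first occurrence of its own variable,
which is then `f`. [folklore] -/
theorem IsEnd.first_eq {f f₀ t : Occ φ.length} {s : Fin 6} (h : IsEnd (L φ) f t s) (hf : IsFirst (L φ) f)
    (hf₀ : IsFirst (L φ) f₀) (hv : var (L φ) f₀ = var (L φ) t) : f₀ = f := by
  rcases h with ⟨-, rfl⟩ | ⟨-, hvt, -⟩
  · exact hf₀.eq_of_var_eq hf hv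
  · exact hf₀.eq_of_var_eq hf (hv.trans hvt)

/-- The end condition of the chain of the first occurrence of the variable of `t`, mirrored. [folklore] -/
theorem isEnd_iff_qEnd {f t : Occ φ.length} (hf : IsFirst (L φ) f) (hv : var (L φ) f = var (L φ) t) (s : Fin 6) :
    IsEnd (L φ) f t s ↔ qEnd (3 * φ.length) (V φ) (flat t) s := by
  rw [qEnd, ← isFirst_iff, ← isLast_iff, IsEnd]
  constructor
  · rintro (⟨hs, rfl⟩ | ⟨hs, -, hl⟩)
    · exact Or.inl ⟨by rw [hs]; rfl, hf⟩
    · exact Or.inr ⟨by rw [hs]; rfl, hl⟩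
  · rintro (⟨hs, ht⟩ | ⟨hs, hl⟩)
    · exact Or.inl ⟨Fin.ext hs, (ht.eq_of_var_eq hf hv.symm)⟩
    · exact Or.inr ⟨Fin.ext hs, hv.symm, hl⟩

/-- **Arcs into the hub, mirrored.** [folklore] -/
theorem exists_isLastFirst_iff (t : Occ φ.length) (s : Fin 6) :
    (∃ f, IsLastFirst (L φ) f ∧ IsEnd (L φ) f t s) ↔
      qLastFirst (3 * φ.length) (V φ) (flat t) ∧ qEnd (3 * φ.length) (V φ) (flat t) s := by
  obtain ⟨f₀, hf₀, hv₀⟩ := exists_isFirst (L := L φ) t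
  have key : qLastFirst (3 * φ.length) (V φ) (flat t) ↔ ∀ f' : Occ φ.length, IsFirst (L φ) f' → flat f' ≤ flat f₀ := by
    simp only [qLastFirst, qExB, ← var_L, forall_flat_iff (m := φ.length), exists_flat_iff (m := φ.length),
      ← isFirst_iff, not_exists, not_and]
    constructor
    · intro h f' hf'
      by_contra hlt
      exact h f' hf' f₀ (by omega) hv₀
    · intro h f' hf' a ha hva
      have h1 := h f' hf'
      have h2 := hf₀ a (hva.trans hv₀.symm)
      omega
  constructor
  · rintro ⟨f, hlf, hend⟩
    have hff : f₀ = f := IsEnd.first_eq hend hlf.1 hf₀ hv₀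
    subst hff
    exact ⟨key.2 hlf.2, (isEnd_iff_qEnd hf₀ hv₀ s).1 hend⟩
  · rintro ⟨hlf, hend⟩
    exact ⟨f₀, ⟨hf₀, key.1 hlf⟩, (isEnd_iff_qEnd hf₀ hv₀ s).2 hend⟩

/-- **Arcs out of the hub, mirrored.** [folklore] -/
theorem exists_flat_zero_iff (t : Occ φ.length) (s : Fin 6) :
    (∃ f, flat f = 0 ∧ IsEnd (L φ) f t s) ↔
      ((s : ℕ) = 0 ∧ flat t = 0) ∨ ((s : ℕ) = 5 ∧ V φ (flat t) = V φ 0 ∧ qLast (3 * φ.length) (V φ) (flat t)) := by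
  have h0 : 0 < 3 * φ.length := by have := flat_lt t; omega
  constructor
  · rintro ⟨f, hf0, hend⟩
    rcases hend with ⟨hs, rfl⟩ | ⟨hs, hv, hl⟩
    · exact Or.inl ⟨by rw [hs]; rfl, hf0⟩
    · refine Or.inr ⟨by rw [hs]; rfl, ?_, (isLast_iff φ t).1 hl⟩
      rw [← hf0, ← var_L, ← var_L]
      exact hv
  · rintro (⟨hs, ht⟩ | ⟨hs, hv, hl⟩)
    · exact ⟨t, ht, Or.inl ⟨Fin.ext hs, rfl⟩⟩
    · refine ⟨ofFlat 0 h0, flat_ofFlat _ _, Or.inr ⟨Fin.ext hs, ?_, (isLast_iff φ t).2 hl⟩⟩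
      rw [var_L, var_L, flat_ofFlat]; exact hv

/-- **Links between consecutive chains, mirrored.** [folklore] -/
theorem exists_isNextFirst_iff (t t' : Occ φ.length) (s s' : Fin 6) :
    (∃ f f', IsNextFirst (L φ) f f' ∧ IsEnd (L φ) f t s ∧ IsEnd (L φ) f' t' s') ↔
      qBefore (3 * φ.length) (V φ) (flat t) (flat t') ∧ qNFB (3 * φ.length) (V φ) (flat t) (flat t') ∧
        qEnd (3 * φ.length) (V φ) (flat t) s ∧ qEnd (3 * φ.length) (V φ) (flat t') s' := by
  obtain ⟨f₀, hf₀, hv₀⟩ := exists_isFirst (L := L φ) t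
  obtain ⟨f₁, hf₁, hv₁⟩ := exists_isFirst (L := L φ) t'
  -- the two mirrored order conditions, in terms of `f₀, f₁`
  have hbefore : qBefore (3 * φ.length) (V φ) (flat t) (flat t') ↔ flat f₀ < flat f₁ := by
    simp only [qBefore, qAllNA, ← var_L, forall_flat_iff (m := φ.length), exists_flat_iff (m := φ.length)]
    constructor
    · rintro ⟨a, hva, hall⟩
      have h1 := hf₀ a (hva.trans hv₀.symm)
      by_contra hle
      exact hall f₁ (by omega) hv₁
    · intro hlt
      exact ⟨f₀, hv₀, fun b hb hvb => absurd (hf₁ b (hvb.trans hv₁.symm)) (by omega)⟩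
  have hnfb : qNFB (3 * φ.length) (V φ) (flat t) (flat t') ↔
      ∀ c : Occ φ.length, IsFirst (L φ) c → flat f₀ < flat c → flat f₁ ≤ flat c := by
    simp only [qNFB, qExB, qAllNA, ← var_L, forall_flat_iff (m := φ.length), exists_flat_iff (m := φ.length),
      ← isFirst_iff, not_and, not_forall, not_not, exists_prop]
    constructor
    · intro h c hc hlt
      by_contra hlt'
      obtain ⟨b, hb, hvb⟩ := h c hc ⟨f₀, hlt, hv₀⟩
      have := hf₁ b (hvb.trans hv₁.symm)
      omega
    · rintro h c hc ⟨a, hac, hva⟩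
      have h1 := hf₀ a (hva.trans hv₀.symm)
      have h2 := h c hc (by omega)
      exact ⟨f₁, by omega, hv₁⟩
  constructor
  · rintro ⟨f, f', hnf, hend, hend'⟩
    have e₀ : f₀ = f := IsEnd.first_eq hend hnf.1 hf₀ hv₀
    have e₁ : f₁ = f' := IsEnd.first_eq hend' hnf.2.1 hf₁ hv₁
    subst e₀; subst e₁
    exact ⟨hbefore.2 hnf.2.2.1, hnfb.2 hnf.2.2.2, (isEnd_iff_qEnd hf₀ hv₀ s).1 hend,
      (isEnd_iff_qEnd hf₁ hv₁ s').1 hend'⟩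
  · rintro ⟨hb, hn, hend, hend'⟩
    exact ⟨f₀, f₁, ⟨hf₀, hf₁, hbefore.1 hb, hnfb.1 hn⟩, (isEnd_iff_qEnd hf₀ hv₀ s).2 hend,
      (isEnd_iff_qEnd hf₁ hv₁ s').2 hend'⟩

end Bridge

/-! ### The slot-CNF is satisfiable iff the 3-CNF is -/

section SlotSat

open SatDHam

/-- **The slot presentation preserves satisfiability** (for nonempty clauses of width at most
three): the slot literals of a clause are exactly its literals. [cite: AroraBarakCC2009, Thm. 2.17 (proof)] -/
theorem slotSat_L_iff (φ : CNF ℕ) (hne : ∀ c ∈ φ, c ≠ []) (hw : φ.IsWidthLE 3) : SlotSat (L φ) ↔ φ.Satisfiable := by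
  constructor
  · rintro ⟨σ, hσ⟩
    refine ⟨σ, (CNF.eval_eq_true_iff φ σ).2 fun c hc => ?_⟩
    obtain ⟨j, hj, rfl⟩ := List.getElem_of_mem hc
    obtain ⟨i, hi⟩ := hσ ⟨j, hj⟩
    rw [Clause.eval, List.any_eq_true]
    refine ⟨slotLit φ[j] i, slotLit_mem (hne _ hc) i, ?_⟩
    simpa [Literal.eval, L] using hi
  · rintro ⟨σ, hσ⟩
    refine ⟨σ, fun j => ?_⟩
    have hc := (CNF.eval_eq_true_iff φ σ).1 hσ φ[j] (List.getElem_mem _)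
    rw [Clause.eval, List.any_eq_true] at hc
    obtain ⟨l, hl, hev⟩ := hc
    obtain ⟨i, hi⟩ := exists_slotLit_eq (hw _ (List.getElem_mem _)) hl
    refine ⟨i, ?_⟩
    show σ (slotLit φ[j] i).1 = (slotLit φ[j] i).2
    simp only [Fin.getElem_fin] at hi ⊢
    rw [hi]
    simpa [Literal.eval] using hev

end SlotSat

/-! ### Numbering the vertices of the gadget -/

section Numbering

open SatDHam

/-- The number of vertices of the gadget on `m` clauses: hub, clause vertices, `6` per occurrence. [folklore] -/
def nV (m : ℕ) : ℕ := 1 + m + 18 * m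

/-- `nV m` is the cardinality of `Vtx m`. [folklore] -/
theorem nV_eq_card (m : ℕ) : nV m = Fintype.card (Vtx m) := by rw [card_vtx, nV]; ring

variable {m : ℕ}

/-- The occurrence index of vertex number `u` (meaningful for segment vertices). [folklore] -/
def vt (m u : ℕ) : ℕ := (u - 1 - m) / 6
/-- The position in the segment of vertex number `u`. [folklore] -/
def vs (m u : ℕ) : ℕ := (u - 1 - m) % 6

/-- `vs < 6`. [folklore] -/
theorem vs_lt (m u : ℕ) : vs m u < 6 := Nat.mod_lt _ (by norm_num)

/-- Below `nV m`, the occurrence index is below `3 m` (for `m > 0`). [folklore] -/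
theorem vt_lt {u : ℕ} (hu : u < nV m) (hm : 0 < m) : vt m u < 3 * m := by
  simp only [vt, nV] at *; omega

/-- **The vertex numbered `u`**: `0` the hub, `1 … m` the clause vertices, then the segment vertices
`1 + m + 6 t + s`. [folklore] -/
def dec (m u : ℕ) : Vtx m :=
  if u = 0 then none
  else if h : u - 1 < m then cl ⟨u - 1, h⟩
  else if h' : vt m u < 3 * m then nd (ofFlat (vt m u) h') ⟨vs m u, vs_lt m u⟩
  else none

/-- **The number of a vertex.** [folklore] -/
def enc : Vtx m → ℕ
  | none => 0
  | some (Sum.inl j) => 1 + j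
  | some (Sum.inr (t, s)) => 1 + m + 6 * flat t + s

/-- Numbers are below `nV m`. [folklore] -/
theorem enc_lt (v : Vtx m) : enc v < nV m := by
  rcases v with _ | j | ⟨t, s⟩
  · simp [enc, nV]
  · have := j.2; simp only [enc, nV]; omega
  · have := flat_lt t; have := s.2; simp only [enc, nV]; omega

/-- The clause vertex numbered `u ∈ [1, m]`. [folklore] -/
theorem dec_cl {u : ℕ} (h0 : u ≠ 0) (h : u - 1 < m) : dec m u = cl ⟨u - 1, h⟩ := by
  simp [dec, h0, h]

/-- The segment vertex numbered `u > m`. [folklore] -/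
theorem dec_nd {u : ℕ} (h0 : u ≠ 0) (h : ¬u - 1 < m) (h' : vt m u < 3 * m) :
    dec m u = nd (ofFlat (vt m u) h') ⟨vs m u, vs_lt m u⟩ := by
  simp [dec, h0, h, h']

/-- `dec ∘ enc = id`. [folklore] -/
theorem dec_enc (v : Vtx m) : dec m (enc v) = v := by
  rcases v with _ | j | ⟨t, s⟩
  · simp [dec, enc]
  · have hj := j.2
    show dec m (1 + j) = _
    rw [dec_cl (by omega) (by omega)]
    simp only [show 1 + (j : ℕ) - 1 = j by omega]
  · have ht := flat_lt t; have hs := s.2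
    show dec m (1 + m + 6 * flat t + s) = _
    have h3 : vt m (1 + m + 6 * flat t + s) = flat t := by simp only [vt]; omega
    have h4 : vs m (1 + m + 6 * flat t + s) = s := by simp only [vs]; omega
    rw [dec_nd (by omega) (by omega) (by rw [h3]; exact ht)]
    have key : ∀ (a : ℕ) (ha : a < 3 * m), a = flat t → ofFlat a ha = t := by
      rintro a ha rfl; exact ofFlat_flat t ha
    simp only [Option.some.injEq, Sum.inr.injEq, Prod.mk.injEq]
    exact ⟨key _ _ h3, Fin.ext h4⟩

/-- `enc ∘ dec = id` below `nV m`. [folklore] -/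
theorem enc_dec {u : ℕ} (hu : u < nV m) : enc (dec m u) = u := by
  unfold dec
  by_cases h0 : u = 0
  · simp [h0, enc]
  · rw [if_neg h0]
    by_cases h1 : u - 1 < m
    · rw [dif_pos h1]; simp only [enc]; omega
    · rw [dif_neg h1]
      have hm : 0 < m ∨ m = 0 := by omega
      rcases hm with hm | hm
      · rw [dif_pos (vt_lt hu hm)]
        simp only [enc, flat_ofFlat]
        simp only [vt, vs]; simp only [nV] at hu; omega
      · exfalso; simp only [nV, hm] at hu h1; omega

/-- `enc` is injective. [folklore] -/
theorem enc_injective : Function.Injective (enc (m := m)) := fun v v' h => by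
  rw [← dec_enc v, h, dec_enc]

/-! ### The arc relation on vertex numbers, mirrored -/

/-- **The arcs of the gadget on vertex numbers**, through the mirrored predicates (this is what the
machine computes). [cite: AroraBarakCC2009, Thm. 2.17 (proof: the reduction)] -/
def arcQ (m : ℕ) (W : ℕ → ℕ) (P : ℕ → Bool) (u v : ℕ) : Prop :=
  if u = 0 then
    if v = 0 then True
    else if v ≤ m then False
    else (vs m v = 0 ∧ vt m v = 0) ∨ (vs m v = 5 ∧ W (vt m v) = W 0 ∧ qLast (3 * m) W (vt m v))
  else if u ≤ m then
    if v = 0 then False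
    else if v ≤ m then False
    else vt m v / 3 = u - 1 ∧ ((P (vt m v) = true ∧ vs m v = 3) ∨ (P (vt m v) = false ∧ vs m v = 2))
  else
    if v = 0 then qLastFirst (3 * m) W (vt m u) ∧ qEnd (3 * m) W (vt m u) (vs m u)
    else if v ≤ m then vt m u / 3 = v - 1 ∧ ((P (vt m u) = true ∧ vs m u = 2) ∨ (P (vt m u) = false ∧ vs m u = 3))
    else (vt m u = vt m v ∧ (vs m u + 1 = vs m v ∨ vs m v + 1 = vs m u)) ∨
      (vs m u = 5 ∧ vs m v = 0 ∧ qNext (3 * m) W (vt m u) (vt m v)) ∨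
      (vs m u = 0 ∧ vs m v = 5 ∧ qNext (3 * m) W (vt m v) (vt m u)) ∨
      (qBefore (3 * m) W (vt m u) (vt m v) ∧ qNFB (3 * m) W (vt m u) (vt m v) ∧
        qEnd (3 * m) W (vt m u) (vs m u) ∧ qEnd (3 * m) W (vt m v) (vs m v))

/-- `arcQ` is decidable. [folklore] -/
instance (m : ℕ) (W : ℕ → ℕ) (P : ℕ → Bool) (u v : ℕ) : Decidable (arcQ m W P u v) := by
  unfold arcQ; infer_instance

variable (φ : CNF ℕ)

/-- **The mirrored arcs are the arcs of the gadget** (below `nV m`).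
[cite: AroraBarakCC2009, Thm. 2.17 (proof: the reduction)] -/
theorem arcQ_iff {u v : ℕ} (hu : u < nV φ.length) (hv : v < nV φ.length) :
    arcQ φ.length (V φ) (Pb φ) u v ↔ Arc (L φ) (dec φ.length u) (dec φ.length v) := by
  have hm : 0 < φ.length ∨ φ.length = 0 := by omega
  rcases hm with hm | hm
  swap
  · -- no clauses: both vertices are the hub
    have hu0 : u = 0 := by simp only [nV, hm] at hu; omega
    have hv0 : v = 0 := by simp only [nV, hm] at hv; omega
    subst hu0; subst hv0
    simp [arcQ, dec, Arc]
  unfold arcQ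
  by_cases hu0 : u = 0
  · subst hu0
    rw [if_pos rfl, show dec φ.length 0 = none by simp [dec]]
    by_cases hv0 : v = 0
    · subst hv0; simp [dec, Arc]
    · rw [if_neg hv0]
      by_cases hvc : v ≤ φ.length
      · rw [if_pos hvc, dec_cl hv0 (by omega)]; simp [Arc]
      · rw [if_neg hvc, dec_nd hv0 (by omega) (vt_lt hv hm), Arc, exists_flat_zero_iff, flat_ofFlat]
  · rw [if_neg hu0]
    by_cases huc : u ≤ φ.length
    · rw [if_pos huc, dec_cl hu0 (by omega)]
      by_cases hv0 : v = 0
      · subst hv0; simp [dec, Arc]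
      · rw [if_neg hv0]
        by_cases hvc : v ≤ φ.length
        · rw [if_pos hvc, dec_cl hv0 (by omega)]; simp [Arc]
        · rw [if_neg hvc, dec_nd hv0 (by omega) (vt_lt hv hm), Arc, pol_L, flat_ofFlat]
          simp only [ofFlat, Fin.ext_iff]
          have h3 : ((3 : Fin 6) : ℕ) = 3 := rfl
          have h2 : ((2 : Fin 6) : ℕ) = 2 := rfl
          rw [h3, h2]
    · rw [if_neg huc, dec_nd hu0 (by omega) (vt_lt hu hm)]
      by_cases hv0 : v = 0
      · subst hv0
        rw [if_pos rfl, show dec φ.length 0 = none by simp [dec], Arc, exists_isLastFirst_iff, flat_ofFlat]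
      · rw [if_neg hv0]
        by_cases hvc : v ≤ φ.length
        · rw [if_pos hvc, dec_cl hv0 (by omega), Arc, pol_L, flat_ofFlat]
          simp only [ofFlat, Fin.ext_iff]
          have h3 : ((3 : Fin 6) : ℕ) = 3 := rfl
          have h2 : ((2 : Fin 6) : ℕ) = 2 := rfl
          rw [h3, h2]
        · rw [if_neg hvc, dec_nd hv0 (by omega) (vt_lt hv hm)]
          set t := ofFlat (m := φ.length) (vt φ.length u) (vt_lt hu hm) with ht
          set t' := ofFlat (m := φ.length) (vt φ.length v) (vt_lt hv hm) with ht'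
          have hft : flat t = vt φ.length u := flat_ofFlat _ _
          have hft' : flat t' = vt φ.length v := flat_ofFlat _ _
          rw [Arc, isNextOcc_iff, isNextOcc_iff, exists_isNextFirst_iff, ← flat_inj, hft, hft']
          have h5 : ((5 : Fin 6) : ℕ) = 5 := rfl
          have h0 : ((0 : Fin 6) : ℕ) = 0 := rfl
          simp only [Fin.ext_iff, h5, h0]

/-! ### The output digraph and the transfer of Hamiltonian cycles along the numbering -/

/-- **The output digraph**: the adjacency matrix of the gadget on vertex numbers.
[cite: AroraBarakCC2009, Thm. 2.17 (proof: the reduction)] -/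
def outDigraph : Fin (nV φ.length) → Fin (nV φ.length) → Bool := fun u v => decide (arcQ φ.length (V φ) (Pb φ) u v)

/-- Transport of a Hamiltonian cycle listing along a pair of inverse maps compatible with the
relations. [folklore] -/
theorem _root_.Literature.Combinatorics.SimpleGraph.IsHamCycleListing.map_of_inverse {α β : Type*} [DecidableEq α]
    [DecidableEq β] {Rα : α → α → Prop} {Rβ : β → β → Prop} (f : α → β) (g : β → α) (hgf : ∀ a, g (f a) = a)
    (hfg : ∀ b, f (g b) = b) (hR : ∀ a a', Rα a a' → Rβ (f a) (f a')) {l : List α} (h : IsHamCycleListing Rα l) :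
    IsHamCycleListing Rβ (l.map f) := by
  have hinj : Function.Injective f := fun a a' e => by rw [← hgf a, e, hgf]
  refine ⟨h.nodup.map hinj, fun b => ?_, fun i hi => ?_⟩
  · rw [← hfg b]; exact List.mem_map_of_mem (h.mem _)
  · simp only [List.getElem_map, List.length_map]
    exact hR _ _ (h.rel i (by simpa using hi))

/-- **The output digraph has a directed Hamiltonian cycle iff the gadget has one.** [folklore] -/
theorem outDigraph_mem_dhamCircuitSet_iff :
    (⟨nV φ.length, outDigraph φ⟩ : Σ n, Fin n → Fin n → Bool) ∈ dhamCircuitSet ↔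
      ∃ l : List (Vtx φ.length), l ≠ [] ∧ IsHamCycleListing (Arc (L φ)) l := by
  rw [mem_dhamCircuitSet_iff]
  dsimp only
  -- the numbering as maps between `Vtx` and `Fin (nV m)`
  set f : Vtx φ.length → Fin (nV φ.length) := fun x => ⟨enc x, enc_lt x⟩ with hf
  set g : Fin (nV φ.length) → Vtx φ.length := fun u => dec φ.length u with hg
  have hgf : ∀ x, g (f x) = x := fun x => dec_enc x
  have hfg : ∀ u, f (g u) = u := fun u => Fin.ext (enc_dec u.2)
  have hR : ∀ u v : Fin (nV φ.length), outDigraph φ u v = true ↔ Arc (L φ) (g u) (g v) := fun u v => by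
    rw [outDigraph, decide_eq_true_iff, arcQ_iff φ u.2 v.2]
  constructor
  · rintro ⟨l, hl0, hl⟩
    refine ⟨l.map g, by simpa using hl0, hl.map_of_inverse g f hfg hgf fun u v huv => (hR u v).1 huv⟩
  · rintro ⟨l, hl0, hl⟩
    refine ⟨l.map f, by simpa using hl0, hl.map_of_inverse f g hgf hfg fun x y hxy => (hR _ _).2 ?_⟩
    rwa [hgf, hgf]

/-- **The output digraph is a yes-instance iff `φ` is satisfiable.**
[cite: AroraBarakCC2009, Thm. 2.17] [cite: Karp1972, §4 Main Theorem, problem 9] -/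
theorem outDigraph_mem_dhamCircuitSet_iff_satisfiable (hne : ∀ c ∈ φ, c ≠ []) (hw : φ.IsWidthLE 3) :
    (⟨nV φ.length, outDigraph φ⟩ : Σ n, Fin n → Fin n → Bool) ∈ dhamCircuitSet ↔ φ.Satisfiable := by
  rw [outDigraph_mem_dhamCircuitSet_iff, ← slotSat_iff_exists_isHamCycleListing, slotSat_L_iff φ hne hw]

end Numbering

/-! ### The arc bit at a flat index: the machine mirror of `arcQ` -/

section ArcMachine

/-- On `⟨w, 1ᴷ⟩`: the input. [folklore] -/
def wZ : List Bool → List Bool := fstF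
/-- On `⟨w, 1ᴷ⟩`: `1ᵐ`. [folklore] -/
def mZ : List Bool → List Bool := onesFn ∘ fstF ∘ fstF
/-- On `⟨w, 1ᴷ⟩`: `1^{3m}`. [folklore] -/
def t3Z : List Bool → List Bool := t3F ∘ fstF
/-- On `⟨w, 1ᴷ⟩`: `1^{18 m}` (six copies of `1^{3m}`). [folklore] -/
def m18Z : List Bool → List Bool :=
  appF ∘ fanoutFn t3Z (appF ∘ fanoutFn t3Z (appF ∘ fanoutFn t3Z (appF ∘ fanoutFn t3Z (appF ∘ fanoutFn t3Z t3Z))))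
/-- On `⟨w, 1ᴷ⟩`: `1ᴺ`, `N = 1 + m + 18 m` the number of vertices. [folklore] -/
def nZ : List Bool → List Bool := List.cons true ∘ appF ∘ fanoutFn mZ m18Z
/-- On `⟨w, 1ᴷ⟩`: `⟨1^{K / N}, 1^{K mod N}⟩`, the two vertex numbers. [folklore] -/
def uvZ : List Bool → List Bool := divModFn ∘ fanoutFn nZ sndF
/-- The first vertex number `1ᵘ`. [folklore] -/
def uZ : List Bool → List Bool := fstF ∘ uvZ
/-- The second vertex number `1ᵛ`. [folklore] -/
def vZ : List Bool → List Bool := sndF ∘ uvZ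
/-- The constant field `1⁰`. [folklore] -/
def zeroZ : List Bool → List Bool := fun _ => []
/-- `[the vertex number is 0]` (the hub). [folklore] -/
def is0 (g : List Bool → List Bool) : List Bool → List Bool := isNilFn ∘ g
/-- `[the vertex number is at most m]`. [folklore] -/
def leM (g : List Bool → List Bool) : List Bool → List Bool := notFn (ltOf mZ g)
/-- The clause index `1^{u-1}` of a vertex number. [folklore] -/
def jOf (g : List Bool → List Bool) : List Bool → List Bool := List.tail ∘ g
/-- `1^{u - 1 - m}`. [folklore] -/
def rOf (g : List Bool → List Bool) : List Bool → List Bool := dropFn ∘ fanoutFn (List.cons true ∘ mZ) g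
/-- `⟨1^{vt}, 1^{vs}⟩`: occurrence index and segment position of a vertex number. [folklore] -/
def tsOf (g : List Bool → List Bool) : List Bool → List Bool := divModFn ∘ fanoutFn (fun _ => ones 6) (rOf g)
/-- The occurrence index `1^{vt m u}`. [folklore] -/
def tOf' (g : List Bool → List Bool) : List Bool → List Bool := fstF ∘ tsOf g
/-- The segment position `1^{vs m u}`. [folklore] -/
def sOf' (g : List Bool → List Bool) : List Bool → List Bool := sndF ∘ tsOf g
/-- `[the unary field has value k]`. [folklore] -/
def eqC (g : List Bool → List Bool) (k : ℕ) : List Bool → List Bool := eqPairFn ∘ fanoutFn g fun _ => ones k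
/-- `[the two unary fields are equal]`. [folklore] -/
def eqU (g h : List Bool → List Bool) : List Bool → List Bool := eqPairFn ∘ fanoutFn g h
/-- `[g + 1 = h]` for unary fields. [folklore] -/
def eqS (g h : List Bool → List Bool) : List Bool → List Bool := eqPairFn ∘ fanoutFn (List.cons true ∘ g) h
/-- `[t / 3 = j]`: the clause of the occurrence field `g` is the clause-index field `h`. [folklore] -/
def eq3 (g h : List Bool → List Bool) : List Bool → List Bool :=
  eqPairFn ∘ fanoutFn (fstF ∘ divModFn ∘ fanoutFn (fun _ => ones 3) g) h
/-- `[the occurrence of field g is positive]`. [folklore] -/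
def polOf (g : List Bool → List Bool) : List Bool → List Bool := polF ∘ fanoutFn wZ g
/-- The end condition of the segment vertex with occurrence field `t` and position field `s`. [folklore] -/
def endZ (t s : List Bool → List Bool) : List Bool → List Bool :=
  orFn (andFn (eqC s 0) (firstF ∘ mkR wZ t zeroZ)) (andFn (eqC s 5) (lastF ∘ mkR wZ t zeroZ))

/-- Leaf: hub → segment vertex. [folklore] -/
def hubSegZ : List Bool → List Bool :=
  orFn (andFn (eqC (sOf' vZ) 0) (eqC (tOf' vZ) 0))
    (andFn (eqC (sOf' vZ) 5) (andFn (veqOf wZ (tOf' vZ) zeroZ) (lastF ∘ mkR wZ (tOf' vZ) zeroZ)))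
/-- Leaf: clause vertex → segment vertex. [folklore] -/
def clSegZ : List Bool → List Bool :=
  andFn (eq3 (tOf' vZ) (jOf uZ))
    (orFn (andFn (polOf (tOf' vZ)) (eqC (sOf' vZ) 3)) (andFn (notFn (polOf (tOf' vZ))) (eqC (sOf' vZ) 2)))
/-- Leaf: segment vertex → hub. [folklore] -/
def segHubZ : List Bool → List Bool := andFn (lastFirstF ∘ mkR wZ (tOf' uZ) zeroZ) (endZ (tOf' uZ) (sOf' uZ))
/-- Leaf: segment vertex → clause vertex. [folklore] -/
def segClZ : List Bool → List Bool :=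
  andFn (eq3 (tOf' uZ) (jOf vZ))
    (orFn (andFn (polOf (tOf' uZ)) (eqC (sOf' uZ) 2)) (andFn (notFn (polOf (tOf' uZ))) (eqC (sOf' uZ) 3)))
/-- Leaf: segment vertex → segment vertex. [folklore] -/
def segSegZ : List Bool → List Bool :=
  orFn (andFn (eqU (tOf' uZ) (tOf' vZ)) (orFn (eqS (sOf' uZ) (sOf' vZ)) (eqS (sOf' vZ) (sOf' uZ))))
    (orFn (andFn (eqC (sOf' uZ) 5) (andFn (eqC (sOf' vZ) 0) (nextF ∘ mkR wZ (tOf' uZ) (tOf' vZ))))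
      (orFn (andFn (eqC (sOf' uZ) 0) (andFn (eqC (sOf' vZ) 5) (nextF ∘ mkR wZ (tOf' vZ) (tOf' uZ))))
        (andFn (beforeF ∘ mkR wZ (tOf' uZ) (tOf' vZ)) (andFn (nfbF ∘ mkR wZ (tOf' uZ) (tOf' vZ))
          (andFn (endZ (tOf' uZ) (sOf' uZ)) (endZ (tOf' vZ) (sOf' vZ)))))))

/-- **The arc bit** at the flat index of the record: dispatch on the kinds of the two vertices, then
the leaves above — the brick mirror of `arcQ`. [cite: AroraBarakCC2009, Thm. 2.17 (proof: the reduction)] -/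
def arcZ : List Bool → List Bool :=
  iteFn (is0 uZ) (iteFn (is0 vZ) (fun _ => [true]) (iteFn (leM vZ) (fun _ => [false]) hubSegZ))
    (iteFn (leM uZ) (iteFn (is0 vZ) (fun _ => [false]) (iteFn (leM vZ) (fun _ => [false]) clSegZ))
      (iteFn (is0 vZ) segHubZ (iteFn (leM vZ) segClZ segSegZ)))

/-! #### Membership in `FP` and one-bit outputs -/

/-- `wZ ∈ FP`. [cite: AroraBarakCC2009, §1.3] -/
theorem wZ_mem_FP : wZ ∈ FP := fstF_mem_FP
/-- `mZ ∈ FP`. [cite: AroraBarakCC2009, §1.3] -/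
theorem mZ_mem_FP : mZ ∈ FP := comp_mem_FP onesFn_mem_FP (comp_mem_FP fstF_mem_FP fstF_mem_FP)
/-- `t3Z ∈ FP`. [cite: AroraBarakCC2009, §1.3] -/
theorem t3Z_mem_FP : t3Z ∈ FP := comp_mem_FP t3F_mem_FP fstF_mem_FP
/-- `m18Z ∈ FP`. [cite: AroraBarakCC2009, §1.3] -/
theorem m18Z_mem_FP : m18Z ∈ FP :=
  comp_mem_FP appF_mem_FP (fanoutFn_mem_FP t3Z_mem_FP (comp_mem_FP appF_mem_FP (fanoutFn_mem_FP t3Z_mem_FP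
    (comp_mem_FP appF_mem_FP (fanoutFn_mem_FP t3Z_mem_FP (comp_mem_FP appF_mem_FP (fanoutFn_mem_FP t3Z_mem_FP
      (comp_mem_FP appF_mem_FP (fanoutFn_mem_FP t3Z_mem_FP t3Z_mem_FP)))))))))
/-- `nZ ∈ FP`. [cite: AroraBarakCC2009, §1.3] -/
theorem nZ_mem_FP : nZ ∈ FP :=
  comp_mem_FP (cons_mem_FP true) (comp_mem_FP appF_mem_FP (fanoutFn_mem_FP mZ_mem_FP m18Z_mem_FP))
/-- `uvZ ∈ FP`. [cite: AroraBarakCC2009, §1.3] -/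
theorem uvZ_mem_FP : uvZ ∈ FP := comp_mem_FP divModFn_mem_FP (fanoutFn_mem_FP nZ_mem_FP sndF_mem_FP)
/-- `uZ ∈ FP`. [cite: AroraBarakCC2009, §1.3] -/
theorem uZ_mem_FP : uZ ∈ FP := comp_mem_FP fstF_mem_FP uvZ_mem_FP
/-- `vZ ∈ FP`. [cite: AroraBarakCC2009, §1.3] -/
theorem vZ_mem_FP : vZ ∈ FP := comp_mem_FP sndF_mem_FP uvZ_mem_FP
/-- `zeroZ ∈ FP`. [cite: AroraBarakCC2009, §1.3] -/
theorem zeroZ_mem_FP : zeroZ ∈ FP := const_mem_FP _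
/-- `is0 ∈ FP`. [cite: AroraBarakCC2009, §1.3] -/
theorem is0_mem_FP {g : List Bool → List Bool} (hg : g ∈ FP) : is0 g ∈ FP := comp_mem_FP isNilFn_mem_FP hg
/-- `leM ∈ FP`. [cite: AroraBarakCC2009, §1.3] -/
theorem leM_mem_FP {g : List Bool → List Bool} (hg : g ∈ FP) : leM g ∈ FP := notFn_mem_FP (ltOf_mem_FP mZ_mem_FP hg)
/-- `jOf ∈ FP`. [cite: AroraBarakCC2009, §1.3] -/
theorem jOf_mem_FP {g : List Bool → List Bool} (hg : g ∈ FP) : jOf g ∈ FP := comp_mem_FP PRelSigma.tail_mem_FP hg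
/-- `rOf ∈ FP`. [cite: AroraBarakCC2009, §1.3] -/
theorem rOf_mem_FP {g : List Bool → List Bool} (hg : g ∈ FP) : rOf g ∈ FP :=
  comp_mem_FP dropFn_mem_FP (fanoutFn_mem_FP (comp_mem_FP (cons_mem_FP true) mZ_mem_FP) hg)
/-- `tsOf ∈ FP`. [cite: AroraBarakCC2009, §1.3] -/
theorem tsOf_mem_FP {g : List Bool → List Bool} (hg : g ∈ FP) : tsOf g ∈ FP :=
  comp_mem_FP divModFn_mem_FP (fanoutFn_mem_FP (const_mem_FP _) (rOf_mem_FP hg))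
/-- `tOf' ∈ FP`. [cite: AroraBarakCC2009, §1.3] -/
theorem tOf'_mem_FP {g : List Bool → List Bool} (hg : g ∈ FP) : tOf' g ∈ FP := comp_mem_FP fstF_mem_FP (tsOf_mem_FP hg)
/-- `sOf' ∈ FP`. [cite: AroraBarakCC2009, §1.3] -/
theorem sOf'_mem_FP {g : List Bool → List Bool} (hg : g ∈ FP) : sOf' g ∈ FP := comp_mem_FP sndF_mem_FP (tsOf_mem_FP hg)
/-- `eqC ∈ FP`. [cite: AroraBarakCC2009, §1.3] -/
theorem eqC_mem_FP {g : List Bool → List Bool} (hg : g ∈ FP) (k : ℕ) : eqC g k ∈ FP :=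
  comp_mem_FP eqPairFn_mem_FP (fanoutFn_mem_FP hg (const_mem_FP _))
/-- `eqU ∈ FP`. [cite: AroraBarakCC2009, §1.3] -/
theorem eqU_mem_FP {g h : List Bool → List Bool} (hg : g ∈ FP) (hh : h ∈ FP) : eqU g h ∈ FP :=
  comp_mem_FP eqPairFn_mem_FP (fanoutFn_mem_FP hg hh)
/-- `eqS ∈ FP`. [cite: AroraBarakCC2009, §1.3] -/
theorem eqS_mem_FP {g h : List Bool → List Bool} (hg : g ∈ FP) (hh : h ∈ FP) : eqS g h ∈ FP :=
  comp_mem_FP eqPairFn_mem_FP (fanoutFn_mem_FP (comp_mem_FP (cons_mem_FP true) hg) hh)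
/-- `eq3 ∈ FP`. [cite: AroraBarakCC2009, §1.3] -/
theorem eq3_mem_FP {g h : List Bool → List Bool} (hg : g ∈ FP) (hh : h ∈ FP) : eq3 g h ∈ FP :=
  comp_mem_FP eqPairFn_mem_FP (fanoutFn_mem_FP (comp_mem_FP fstF_mem_FP (comp_mem_FP divModFn_mem_FP
    (fanoutFn_mem_FP (const_mem_FP _) hg))) hh)
/-- `polOf ∈ FP`. [cite: AroraBarakCC2009, §1.3] -/
theorem polOf_mem_FP {g : List Bool → List Bool} (hg : g ∈ FP) : polOf g ∈ FP :=
  comp_mem_FP polF_mem_FP (fanoutFn_mem_FP wZ_mem_FP hg)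
/-- `endZ ∈ FP`. [cite: AroraBarakCC2009, §1.3] -/
theorem endZ_mem_FP {t s : List Bool → List Bool} (ht : t ∈ FP) (hs : s ∈ FP) : endZ t s ∈ FP :=
  orFn_mem_FP (andFn_mem_FP (eqC_mem_FP hs 0) (comp_mem_FP firstF_mem_FP (mkR_mem_FP wZ_mem_FP ht zeroZ_mem_FP)))
    (andFn_mem_FP (eqC_mem_FP hs 5) (comp_mem_FP lastF_mem_FP (mkR_mem_FP wZ_mem_FP ht zeroZ_mem_FP)))

/-- `hubSegZ ∈ FP`. [cite: AroraBarakCC2009, §1.3] -/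
theorem hubSegZ_mem_FP : hubSegZ ∈ FP :=
  orFn_mem_FP (andFn_mem_FP (eqC_mem_FP (sOf'_mem_FP vZ_mem_FP) 0) (eqC_mem_FP (tOf'_mem_FP vZ_mem_FP) 0))
    (andFn_mem_FP (eqC_mem_FP (sOf'_mem_FP vZ_mem_FP) 5) (andFn_mem_FP (veqOf_mem_FP wZ_mem_FP (tOf'_mem_FP vZ_mem_FP) zeroZ_mem_FP)
      (comp_mem_FP lastF_mem_FP (mkR_mem_FP wZ_mem_FP (tOf'_mem_FP vZ_mem_FP) zeroZ_mem_FP))))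
/-- `clSegZ ∈ FP`. [cite: AroraBarakCC2009, §1.3] -/
theorem clSegZ_mem_FP : clSegZ ∈ FP :=
  andFn_mem_FP (eq3_mem_FP (tOf'_mem_FP vZ_mem_FP) (jOf_mem_FP uZ_mem_FP))
    (orFn_mem_FP (andFn_mem_FP (polOf_mem_FP (tOf'_mem_FP vZ_mem_FP)) (eqC_mem_FP (sOf'_mem_FP vZ_mem_FP) 3))
      (andFn_mem_FP (notFn_mem_FP (polOf_mem_FP (tOf'_mem_FP vZ_mem_FP))) (eqC_mem_FP (sOf'_mem_FP vZ_mem_FP) 2)))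
/-- `segHubZ ∈ FP`. [cite: AroraBarakCC2009, §1.3] -/
theorem segHubZ_mem_FP : segHubZ ∈ FP :=
  andFn_mem_FP (comp_mem_FP lastFirstF_mem_FP (mkR_mem_FP wZ_mem_FP (tOf'_mem_FP uZ_mem_FP) zeroZ_mem_FP))
    (endZ_mem_FP (tOf'_mem_FP uZ_mem_FP) (sOf'_mem_FP uZ_mem_FP))
/-- `segClZ ∈ FP`. [cite: AroraBarakCC2009, §1.3] -/
theorem segClZ_mem_FP : segClZ ∈ FP :=
  andFn_mem_FP (eq3_mem_FP (tOf'_mem_FP uZ_mem_FP) (jOf_mem_FP vZ_mem_FP))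
    (orFn_mem_FP (andFn_mem_FP (polOf_mem_FP (tOf'_mem_FP uZ_mem_FP)) (eqC_mem_FP (sOf'_mem_FP uZ_mem_FP) 2))
      (andFn_mem_FP (notFn_mem_FP (polOf_mem_FP (tOf'_mem_FP uZ_mem_FP))) (eqC_mem_FP (sOf'_mem_FP uZ_mem_FP) 3)))
/-- `segSegZ ∈ FP`. [cite: AroraBarakCC2009, §1.3] -/
theorem segSegZ_mem_FP : segSegZ ∈ FP :=
  orFn_mem_FP (andFn_mem_FP (eqU_mem_FP (tOf'_mem_FP uZ_mem_FP) (tOf'_mem_FP vZ_mem_FP))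
      (orFn_mem_FP (eqS_mem_FP (sOf'_mem_FP uZ_mem_FP) (sOf'_mem_FP vZ_mem_FP))
        (eqS_mem_FP (sOf'_mem_FP vZ_mem_FP) (sOf'_mem_FP uZ_mem_FP))))
    (orFn_mem_FP (andFn_mem_FP (eqC_mem_FP (sOf'_mem_FP uZ_mem_FP) 5) (andFn_mem_FP (eqC_mem_FP (sOf'_mem_FP vZ_mem_FP) 0)
        (comp_mem_FP nextF_mem_FP (mkR_mem_FP wZ_mem_FP (tOf'_mem_FP uZ_mem_FP) (tOf'_mem_FP vZ_mem_FP)))))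
      (orFn_mem_FP (andFn_mem_FP (eqC_mem_FP (sOf'_mem_FP uZ_mem_FP) 0) (andFn_mem_FP (eqC_mem_FP (sOf'_mem_FP vZ_mem_FP) 5)
          (comp_mem_FP nextF_mem_FP (mkR_mem_FP wZ_mem_FP (tOf'_mem_FP vZ_mem_FP) (tOf'_mem_FP uZ_mem_FP)))))
        (andFn_mem_FP (comp_mem_FP beforeF_mem_FP (mkR_mem_FP wZ_mem_FP (tOf'_mem_FP uZ_mem_FP) (tOf'_mem_FP vZ_mem_FP)))
          (andFn_mem_FP (comp_mem_FP nfbF_mem_FP (mkR_mem_FP wZ_mem_FP (tOf'_mem_FP uZ_mem_FP) (tOf'_mem_FP vZ_mem_FP)))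
            (andFn_mem_FP (endZ_mem_FP (tOf'_mem_FP uZ_mem_FP) (sOf'_mem_FP uZ_mem_FP))
              (endZ_mem_FP (tOf'_mem_FP vZ_mem_FP) (sOf'_mem_FP vZ_mem_FP)))))))

/-- **`arcZ ∈ FP`.** [cite: AroraBarakCC2009, §1.3] -/
theorem arcZ_mem_FP : arcZ ∈ FP :=
  iteFn_mem_FP (is0_mem_FP uZ_mem_FP)
    (iteFn_mem_FP (is0_mem_FP vZ_mem_FP) (const_mem_FP _) (iteFn_mem_FP (leM_mem_FP vZ_mem_FP) (const_mem_FP _) hubSegZ_mem_FP))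
    (iteFn_mem_FP (leM_mem_FP uZ_mem_FP)
      (iteFn_mem_FP (is0_mem_FP vZ_mem_FP) (const_mem_FP _) (iteFn_mem_FP (leM_mem_FP vZ_mem_FP) (const_mem_FP _) clSegZ_mem_FP))
      (iteFn_mem_FP (is0_mem_FP vZ_mem_FP) segHubZ_mem_FP (iteFn_mem_FP (leM_mem_FP vZ_mem_FP) segClZ_mem_FP segSegZ_mem_FP)))

/-- `is0` is one-bit. [folklore] -/
theorem oneBit_is0 (g : List Bool → List Bool) : OneBit (is0 g) := oneBit_isNilFn.comp _
/-- `leM` is one-bit. [folklore] -/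
theorem oneBit_leM (g : List Bool → List Bool) : OneBit (leM g) := oneBit_notFn (oneBit_ltOf _ _)
/-- `eqC` is one-bit. [folklore] -/
theorem oneBit_eqC (g : List Bool → List Bool) (k : ℕ) : OneBit (eqC g k) := oneBit_eqPairFn.comp _
/-- `eqU` is one-bit. [folklore] -/
theorem oneBit_eqU (g h : List Bool → List Bool) : OneBit (eqU g h) := oneBit_eqPairFn.comp _
/-- `eqS` is one-bit. [folklore] -/
theorem oneBit_eqS (g h : List Bool → List Bool) : OneBit (eqS g h) := oneBit_eqPairFn.comp _
/-- `eq3` is one-bit. [folklore] -/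
theorem oneBit_eq3 (g h : List Bool → List Bool) : OneBit (eq3 g h) := oneBit_eqPairFn.comp _
/-- `polOf` is one-bit. [folklore] -/
theorem oneBit_polOf (g : List Bool → List Bool) : OneBit (polOf g) := oneBit_polF.comp _
/-- `endZ` is one-bit. [folklore] -/
theorem oneBit_endZ (t s : List Bool → List Bool) : OneBit (endZ t s) :=
  oneBit_orFn (oneBit_andFn (oneBit_eqC _ _) (oneBit_firstF.comp _)) (oneBit_andFn (oneBit_eqC _ _) (oneBit_lastF.comp _))
/-- `hubSegZ` is one-bit. [folklore] -/
theorem oneBit_hubSegZ : OneBit hubSegZ :=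
  oneBit_orFn (oneBit_andFn (oneBit_eqC _ _) (oneBit_eqC _ _))
    (oneBit_andFn (oneBit_eqC _ _) (oneBit_andFn (oneBit_veqOf _ _ _) (oneBit_lastF.comp _)))
/-- `clSegZ` is one-bit. [folklore] -/
theorem oneBit_clSegZ : OneBit clSegZ :=
  oneBit_andFn (oneBit_eq3 _ _) (oneBit_orFn (oneBit_andFn (oneBit_polOf _) (oneBit_eqC _ _))
    (oneBit_andFn (oneBit_notFn (oneBit_polOf _)) (oneBit_eqC _ _)))
/-- `segHubZ` is one-bit. [folklore] -/
theorem oneBit_segHubZ : OneBit segHubZ := oneBit_andFn (oneBit_lastFirstF.comp _) (oneBit_endZ _ _)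
/-- `segClZ` is one-bit. [folklore] -/
theorem oneBit_segClZ : OneBit segClZ :=
  oneBit_andFn (oneBit_eq3 _ _) (oneBit_orFn (oneBit_andFn (oneBit_polOf _) (oneBit_eqC _ _))
    (oneBit_andFn (oneBit_notFn (oneBit_polOf _)) (oneBit_eqC _ _)))
/-- `segSegZ` is one-bit. [folklore] -/
theorem oneBit_segSegZ : OneBit segSegZ :=
  oneBit_orFn (oneBit_andFn (oneBit_eqU _ _) (oneBit_orFn (oneBit_eqS _ _) (oneBit_eqS _ _)))
    (oneBit_orFn (oneBit_andFn (oneBit_eqC _ _) (oneBit_andFn (oneBit_eqC _ _) (oneBit_nextF.comp _)))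
      (oneBit_orFn (oneBit_andFn (oneBit_eqC _ _) (oneBit_andFn (oneBit_eqC _ _) (oneBit_nextF.comp _)))
        (oneBit_andFn (oneBit_beforeF.comp _) (oneBit_andFn (oneBit_nfbF.comp _)
          (oneBit_andFn (oneBit_endZ _ _) (oneBit_endZ _ _))))))

/-- **`arcZ` is one-bit.** [folklore] -/
theorem oneBit_arcZ : OneBit arcZ :=
  (oneBit_is0 _).ite ((oneBit_is0 _).ite (fun _ => ⟨_, rfl⟩) ((oneBit_leM _).ite (fun _ => ⟨_, rfl⟩) oneBit_hubSegZ))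
    ((oneBit_leM _).ite ((oneBit_is0 _).ite (fun _ => ⟨_, rfl⟩) ((oneBit_leM _).ite (fun _ => ⟨_, rfl⟩) oneBit_clSegZ))
      ((oneBit_is0 _).ite oneBit_segHubZ ((oneBit_leM _).ite oneBit_segClZ oneBit_segSegZ)))

end ArcMachine

/-! ### Values of the arc machine on `⟨encode φ, 1ᴷ⟩` -/

section ArcValues

variable (φ : CNF ℕ) (K : ℕ)

/-- The record of the tabulation at flat index `K`. [folklore] -/
def zK : List Bool := boolPair (encodingCNF.encode φ) (ones K)

/-- Value of `wZ` on the tabulation record of a code. [folklore] -/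
@[simp] theorem wZ_zK : wZ (zK φ K) = encodingCNF.encode φ := by simp [wZ, zK]
/-- Value of `fstF` on the tabulation record of a code. [folklore] -/
@[simp] theorem fstF_zK : fstF (zK φ K) = encodingCNF.encode φ := by simp [zK]
/-- Value of `sndF` on the tabulation record of a code. [folklore] -/
@[simp] theorem sndF_zK : sndF (zK φ K) = ones K := by simp [zK]

/-- `mZ = 1ᵐ`. [folklore] -/
@[simp] theorem mZ_zK : mZ (zK φ K) = ones φ.length := by
  simp only [mZ, Function.comp_apply, fstF_zK, encodeCNF_eq, fstF_boolPair, onesFn_eq_ones, List.length_replicate]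

/-- `t3Z = 1^{3m}`. [folklore] -/
@[simp] theorem t3Z_zK : t3Z (zK φ K) = ones (3 * φ.length) := by
  simp only [t3Z, Function.comp_apply, fstF_zK, t3F_apply, mOf_encode]

/-- `m18Z = 1^{18m}`. [folklore] -/
@[simp] theorem m18Z_zK : m18Z (zK φ K) = ones (18 * φ.length) := by
  simp only [m18Z, Function.comp_apply, fanoutFn_apply, appF_boolPair, t3Z_zK, ones, List.replicate_append_replicate]
  congr 1; ring

/-- `nZ = 1ᴺ`. [folklore] -/
@[simp] theorem nZ_zK : nZ (zK φ K) = ones (nV φ.length) := by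
  simp only [nZ, Function.comp_apply, fanoutFn_apply, appF_boolPair, mZ_zK, m18Z_zK, ones, List.replicate_append_replicate]
  rw [show nV φ.length = (φ.length + 18 * φ.length) + 1 by unfold nV; ring, List.replicate_succ]

/-- `uZ = 1^{K / N}`. [folklore] -/
@[simp] theorem uZ_zK : uZ (zK φ K) = ones (K / nV φ.length) := by
  simp only [uZ, uvZ, Function.comp_apply, fanoutFn_apply, nZ_zK, sndF_zK, divModFn_boolPair, fstF_boolPair]

/-- `vZ = 1^{K mod N}`. [folklore] -/
@[simp] theorem vZ_zK : vZ (zK φ K) = ones (K % nV φ.length) := by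
  simp only [vZ, uvZ, Function.comp_apply, fanoutFn_apply, nZ_zK, sndF_zK, divModFn_boolPair, sndF_boolPair]

variable {φ K}
variable {g h : List Bool → List Bool} {n p q : ℕ}

/-- `is0` on a vertex-number field. [folklore] -/
theorem is0_zK (hg : g (zK φ K) = ones n) : is0 g (zK φ K) = [decide (n = 0)] := by
  rw [is0, Function.comp_apply, hg]
  simp only [isNilFn, ones, List.replicate_eq_nil_iff]

/-- `leM` on a vertex-number field. [folklore] -/
theorem leM_zK (hg : g (zK φ K) = ones n) : leM g (zK φ K) = [decide (n ≤ φ.length)] := by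
  rw [leM, notFn_decide (ltOf_apply_of (mZ_zK φ K) hg)]
  congr 1; apply Bool.decide_congr; omega

/-- `jOf` on a vertex-number field. [folklore] -/
theorem jOf_zK (hg : g (zK φ K) = ones n) : jOf g (zK φ K) = ones (n - 1) := by
  rw [jOf, Function.comp_apply, hg]; simp [ones]

/-- `tOf'` on a vertex-number field. [folklore] -/
theorem tOf'_zK (hg : g (zK φ K) = ones n) : tOf' g (zK φ K) = ones (vt φ.length n) := by
  simp only [tOf', tsOf, rOf, Function.comp_apply, fanoutFn_apply, mZ_zK, hg, dropFn_boolPair, List.length_cons,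
    List.length_replicate, ones, List.drop_replicate, divModFn_boolPair, fstF_boolPair, vt]
  congr 2; omega

/-- `sOf'` on a vertex-number field. [folklore] -/
theorem sOf'_zK (hg : g (zK φ K) = ones n) : sOf' g (zK φ K) = ones (vs φ.length n) := by
  simp only [sOf', tsOf, rOf, Function.comp_apply, fanoutFn_apply, mZ_zK, hg, dropFn_boolPair, List.length_cons,
    List.length_replicate, ones, List.drop_replicate, divModFn_boolPair, sndF_boolPair, vs]
  congr 2; omega

/-- `eqC` from the value of the field. [folklore] -/
theorem eqC_zK (hg : g (zK φ K) = ones p) (k : ℕ) : eqC g k (zK φ K) = [decide (p = k)] := by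
  rw [eqC, Function.comp_apply, fanoutFn_apply, hg, eqPairFn_boolPair]
  congr 1; exact Bool.decide_congr (DHamRed.ones_inj_iff _ _)

/-- `eqU` from the values of the fields. [folklore] -/
theorem eqU_zK (hg : g (zK φ K) = ones p) (hh : h (zK φ K) = ones q) : eqU g h (zK φ K) = [decide (p = q)] := by
  rw [eqU, Function.comp_apply, fanoutFn_apply, hg, hh, eqPairFn_boolPair]
  congr 1; exact Bool.decide_congr (DHamRed.ones_inj_iff _ _)

/-- `eqS` from the values of the fields. [folklore] -/
theorem eqS_zK (hg : g (zK φ K) = ones p) (hh : h (zK φ K) = ones q) : eqS g h (zK φ K) = [decide (p + 1 = q)] := by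
  rw [eqS, Function.comp_apply, fanoutFn_apply, Function.comp_apply, hg, hh, show true :: ones p = ones (p + 1) from
    (List.replicate_succ ..).symm, eqPairFn_boolPair]
  congr 1; exact Bool.decide_congr (DHamRed.ones_inj_iff _ _)

/-- `eq3` from the values of the fields. [folklore] -/
theorem eq3_zK (hg : g (zK φ K) = ones p) (hh : h (zK φ K) = ones q) : eq3 g h (zK φ K) = [decide (p / 3 = q)] := by
  rw [eq3, Function.comp_apply, fanoutFn_apply, Function.comp_apply, Function.comp_apply, fanoutFn_apply, hg, hh,
    divModFn_boolPair, fstF_boolPair, eqPairFn_boolPair]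
  congr 1; exact Bool.decide_congr (DHamRed.ones_inj_iff _ _)

/-- `polOf` from the value of the field (an occurrence in range). [folklore] -/
theorem polOf_zK (hne : ∀ c ∈ φ, c ≠ []) (hg : g (zK φ K) = ones p) (hp : p < 3 * φ.length) : polOf g (zK φ K) = [decide (Pb φ p = true)] := by
  rw [polOf, Function.comp_apply, fanoutFn_apply, wZ_zK, hg, polF_encode φ hne hp, Pb_eq φ hp, Bool.decide_eq_true]

/-- A predicate brick through `mkR` on the tabulation record. [folklore] -/
theorem mkR_zK {t s : List Bool → List Bool} {a b : ℕ} (ht : t (zK φ K) = ones a) (hs : s (zK φ K) = ones b) :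
    mkR wZ t s (zK φ K) = R (encodingCNF.encode φ) a b :=
  mkR_apply_of (wZ_zK φ K) ht hs

/-- `endZ` from the values of the fields. [folklore] -/
theorem endZ_zK (hne : ∀ c ∈ φ, c ≠ []) {t s : List Bool → List Bool} {a b : ℕ} (ht : t (zK φ K) = ones a)
    (hs : s (zK φ K) = ones b) (ha : a < 3 * φ.length) : endZ t s (zK φ K) = [decide (qEnd (3 * φ.length) (V φ) a b)] := by
  rw [endZ, orFn_decide (andFn_decide (eqC_zK hs 0) (by rw [Function.comp_apply, mkR_zK ht (zero_field (zK φ K)),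
      firstF_R_encode φ hne _ ha]))
    (andFn_decide (eqC_zK hs 5) (by rw [Function.comp_apply, mkR_zK ht (zero_field (zK φ K)), lastF_R_encode φ hne _ ha]))]
  rfl

variable {u v : ℕ}

/-- Value of the leaf hub → segment. [folklore] -/
theorem hubSegZ_zK (hne : ∀ c ∈ φ, c ≠ []) (hm : 0 < φ.length) (hv : v < nV φ.length) (hgv : vZ (zK φ K) = ones v) : hubSegZ (zK φ K) = [decide ((vs φ.length v = 0 ∧ vt φ.length v = 0) ∨
    (vs φ.length v = 5 ∧ V φ (vt φ.length v) = V φ 0 ∧ qLast (3 * φ.length) (V φ) (vt φ.length v)))] := by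
  have htv := tOf'_zK hgv; have hsv := sOf'_zK hgv
  have h3 : 0 < 3 * φ.length := by omega
  rw [hubSegZ, orFn_decide (andFn_decide (eqC_zK hsv 0) (eqC_zK htv 0))
    (andFn_decide (eqC_zK hsv 5) (andFn_decide
      (by rw [veqOf, Function.comp_apply, mkR_zK htv (zero_field (zK φ K)), veqF_R_encode φ hne (vt_lt hv hm) h3])
      (by rw [Function.comp_apply, mkR_zK htv (zero_field (zK φ K)), lastF_R_encode φ hne _ (vt_lt hv hm)])))]

/-- Value of the leaf clause → segment. [folklore] -/
theorem clSegZ_zK (hne : ∀ c ∈ φ, c ≠ []) (hm : 0 < φ.length) (hv : v < nV φ.length) (hgu : uZ (zK φ K) = ones u)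
    (hgv : vZ (zK φ K) = ones v) : clSegZ (zK φ K) = [decide (vt φ.length v / 3 = u - 1 ∧
    ((Pb φ (vt φ.length v) = true ∧ vs φ.length v = 3) ∨ (¬Pb φ (vt φ.length v) = true ∧ vs φ.length v = 2)))] := by
  have htv := tOf'_zK hgv; have hsv := sOf'_zK hgv
  rw [clSegZ, andFn_decide (eq3_zK htv (jOf_zK hgu)) (orFn_decide (andFn_decide (polOf_zK hne htv (vt_lt hv hm)) (eqC_zK hsv 3))
    (andFn_decide (notFn_decide (polOf_zK hne htv (vt_lt hv hm))) (eqC_zK hsv 2)))]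

/-- Value of the leaf segment → hub. [folklore] -/
theorem segHubZ_zK (hne : ∀ c ∈ φ, c ≠ []) (hm : 0 < φ.length) (hu : u < nV φ.length) (hgu : uZ (zK φ K) = ones u) : segHubZ (zK φ K) = [decide (qLastFirst (3 * φ.length) (V φ) (vt φ.length u) ∧
    qEnd (3 * φ.length) (V φ) (vt φ.length u) (vs φ.length u))] := by
  have htu := tOf'_zK hgu; have hsu := sOf'_zK hgu
  rw [segHubZ, andFn_decide (by rw [Function.comp_apply, mkR_zK htu (zero_field (zK φ K)), lastFirstF_R_encode φ hne _ (vt_lt hu hm)])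
    (endZ_zK hne htu hsu (vt_lt hu hm))]

/-- Value of the leaf segment → clause. [folklore] -/
theorem segClZ_zK (hne : ∀ c ∈ φ, c ≠ []) (hm : 0 < φ.length) (hu : u < nV φ.length) (hgu : uZ (zK φ K) = ones u)
    (hgv : vZ (zK φ K) = ones v) : segClZ (zK φ K) = [decide (vt φ.length u / 3 = v - 1 ∧
    ((Pb φ (vt φ.length u) = true ∧ vs φ.length u = 2) ∨ (¬Pb φ (vt φ.length u) = true ∧ vs φ.length u = 3)))] := by
  have htu := tOf'_zK hgu; have hsu := sOf'_zK hgu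
  rw [segClZ, andFn_decide (eq3_zK htu (jOf_zK hgv)) (orFn_decide (andFn_decide (polOf_zK hne htu (vt_lt hu hm)) (eqC_zK hsu 2))
    (andFn_decide (notFn_decide (polOf_zK hne htu (vt_lt hu hm))) (eqC_zK hsu 3)))]

/-- Value of the leaf segment → segment. [folklore] -/
theorem segSegZ_zK (hne : ∀ c ∈ φ, c ≠ []) (hm : 0 < φ.length) (hu : u < nV φ.length) (hv : v < nV φ.length)
    (hgu : uZ (zK φ K) = ones u) (hgv : vZ (zK φ K) = ones v) : segSegZ (zK φ K) = [decide (
    (vt φ.length u = vt φ.length v ∧ (vs φ.length u + 1 = vs φ.length v ∨ vs φ.length v + 1 = vs φ.length u)) ∨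
    (vs φ.length u = 5 ∧ vs φ.length v = 0 ∧ qNext (3 * φ.length) (V φ) (vt φ.length u) (vt φ.length v)) ∨
    (vs φ.length u = 0 ∧ vs φ.length v = 5 ∧ qNext (3 * φ.length) (V φ) (vt φ.length v) (vt φ.length u)) ∨
    (qBefore (3 * φ.length) (V φ) (vt φ.length u) (vt φ.length v) ∧ qNFB (3 * φ.length) (V φ) (vt φ.length u) (vt φ.length v) ∧
      qEnd (3 * φ.length) (V φ) (vt φ.length u) (vs φ.length u) ∧ qEnd (3 * φ.length) (V φ) (vt φ.length v) (vs φ.length v)))] := by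
  have htu := tOf'_zK hgu; have hsu := sOf'_zK hgu
  have htv := tOf'_zK hgv; have hsv := sOf'_zK hgv
  have hU := vt_lt hu hm; have hV := vt_lt hv hm
  rw [segSegZ, orFn_decide (andFn_decide (eqU_zK htu htv) (orFn_decide (eqS_zK hsu hsv) (eqS_zK hsv hsu)))
    (orFn_decide (andFn_decide (eqC_zK hsu 5) (andFn_decide (eqC_zK hsv 0)
        (by rw [Function.comp_apply, mkR_zK htu htv, nextF_R_encode φ hne hU hV])))
      (orFn_decide (andFn_decide (eqC_zK hsu 0) (andFn_decide (eqC_zK hsv 5)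
          (by rw [Function.comp_apply, mkR_zK htv htu, nextF_R_encode φ hne hV hU])))
        (andFn_decide (by rw [Function.comp_apply, mkR_zK htu htv, beforeF_R_encode φ hne hU hV])
          (andFn_decide (by rw [Function.comp_apply, mkR_zK htu htv, nfbF_R_encode φ hne hU hV])
            (andFn_decide (endZ_zK hne htu hsu hU) (endZ_zK hne htv hsv hV))))))]

/-- `l = [decide Q]` and `P ↔ Q` give `l = [decide P]`. [folklore] -/
theorem eq_decide_of_iff {l : List Bool} {P Q : Prop} {_ : Decidable P} {_ : Decidable Q} (hb : l = [decide Q])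
    (h : P ↔ Q) : l = [decide P] := by
  rw [hb, Bool.decide_congr h]

/-- **Value of the arc bit**: `arcQ` at the two vertex numbers. [cite: AroraBarakCC2009, Thm. 2.17 (proof: the reduction)] -/
theorem arcZ_zK (hne : ∀ c ∈ φ, c ≠ []) (hu : u < nV φ.length) (hv : v < nV φ.length)
    (hgu : uZ (zK φ K) = ones u) (hgv : vZ (zK φ K) = ones v) :
    arcZ (zK φ K) = [decide (arcQ φ.length (V φ) (Pb φ) u v)] := by
  -- a non-hub vertex forces `m > 0`
  have hmz : ∀ {n : ℕ}, n < nV φ.length → n ≠ 0 → 0 < φ.length := fun hn h0 => by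
    rcases Nat.eq_zero_or_pos φ.length with hm | hm
    · simp only [nV, hm] at hn; omega
    · exact hm
  have h0u := is0_zK hgu; have h0v := is0_zK hgv
  have hmu := leM_zK hgu; have hmv := leM_zK hgv
  unfold arcZ
  by_cases hu0 : u = 0
  · rw [iteFn_apply_true (by rw [h0u, decide_eq_true hu0])]
    by_cases hv0 : v = 0
    · rw [iteFn_apply_true (by rw [h0v, decide_eq_true hv0])]
      exact eq_decide_of_iff (Q := True) rfl (by unfold arcQ; rw [if_pos hu0, if_pos hv0])
    · rw [iteFn_apply_false (by rw [h0v, decide_eq_false hv0])]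
      by_cases hvc : v ≤ φ.length
      · rw [iteFn_apply_true (by rw [hmv, decide_eq_true hvc])]
        exact eq_decide_of_iff (Q := False) rfl (by unfold arcQ; rw [if_pos hu0, if_neg hv0, if_pos hvc])
      · rw [iteFn_apply_false (by rw [hmv, decide_eq_false hvc])]
        exact eq_decide_of_iff (hubSegZ_zK hne (hmz hv hv0) hv hgv) (by unfold arcQ; rw [if_pos hu0, if_neg hv0, if_neg hvc])
  · rw [iteFn_apply_false (by rw [h0u, decide_eq_false hu0])]
    by_cases huc : u ≤ φ.length
    · rw [iteFn_apply_true (by rw [hmu, decide_eq_true huc])]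
      by_cases hv0 : v = 0
      · rw [iteFn_apply_true (by rw [h0v, decide_eq_true hv0])]
        exact eq_decide_of_iff (Q := False) rfl (by unfold arcQ; rw [if_neg hu0, if_pos huc, if_pos hv0])
      · rw [iteFn_apply_false (by rw [h0v, decide_eq_false hv0])]
        by_cases hvc : v ≤ φ.length
        · rw [iteFn_apply_true (by rw [hmv, decide_eq_true hvc])]
          exact eq_decide_of_iff (Q := False) rfl (by unfold arcQ; rw [if_neg hu0, if_pos huc, if_neg hv0, if_pos hvc])
        · rw [iteFn_apply_false (by rw [hmv, decide_eq_false hvc])]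
          refine eq_decide_of_iff (clSegZ_zK hne (hmz hv hv0) hv hgu hgv) ?_
          unfold arcQ; rw [if_neg hu0, if_pos huc, if_neg hv0, if_neg hvc]; simp only [Bool.not_eq_true]
    · rw [iteFn_apply_false (by rw [hmu, decide_eq_false huc])]
      by_cases hv0 : v = 0
      · rw [iteFn_apply_true (by rw [h0v, decide_eq_true hv0])]
        exact eq_decide_of_iff (segHubZ_zK hne (hmz hu hu0) hu hgu) (by unfold arcQ; rw [if_neg hu0, if_neg huc, if_pos hv0])
      · rw [iteFn_apply_false (by rw [h0v, decide_eq_false hv0])]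
        by_cases hvc : v ≤ φ.length
        · rw [iteFn_apply_true (by rw [hmv, decide_eq_true hvc])]
          refine eq_decide_of_iff (segClZ_zK hne (hmz hu hu0) hu hgu hgv) ?_
          unfold arcQ; rw [if_neg hu0, if_neg huc, if_neg hv0, if_pos hvc]; simp only [Bool.not_eq_true]
        · rw [iteFn_apply_false (by rw [hmv, decide_eq_false hvc])]
          exact eq_decide_of_iff (segSegZ_zK hne (hmz hu hu0) hu hv hgu hgv)
            (by unfold arcQ; rw [if_neg hu0, if_neg huc, if_neg hv0, if_neg hvc])

end ArcValues

/-! ### The tabulation, the guard and the reduction -/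

section Reduction

/-- `1ᴺ` from the input alone. [folklore] -/
def nW : List Bool → List Bool := nZ ∘ fanoutFn id zeroZ

/-- `nW ∈ FP`. [cite: AroraBarakCC2009, §1.3] -/
theorem nW_mem_FP : nW ∈ FP := comp_mem_FP nZ_mem_FP (fanoutFn_mem_FP OracleCompose.id_mem_FP zeroZ_mem_FP)

/-- Value of `nW` on a code. [folklore] -/
@[simp] theorem nW_encode (φ : CNF ℕ) : nW (encodingCNF.encode φ) = ones (nV φ.length) := by
  rw [nW, Function.comp_apply, fanoutFn_apply]
  exact nZ_zK φ 0

/-- The number of arc bits `N²` in binary. [folklore] -/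
def cntF : List Bool → List Bool := lenBinF ∘ umulFn ∘ fanoutFn nW nW

/-- `cntF ∈ FP`. [cite: AroraBarakCC2009, §1.3] -/
theorem cntF_mem_FP : cntF ∈ FP := comp_mem_FP lenBinF_mem_FP (comp_mem_FP umulFn_mem_FP (fanoutFn_mem_FP nW_mem_FP nW_mem_FP))

/-- Value of `cntF` on a code. [folklore] -/
@[simp] theorem cntF_encode (φ : CNF ℕ) : cntF (encodingCNF.encode φ) = encodeNat (nV φ.length * nV φ.length) := by
  simp [cntF, ones]

/-- The initial record of the tabulation loop. [folklore] -/
def initF : List Bool → List Bool := fanoutFn id (fanoutFn cntF fun _ => boolPair [] [])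

/-- `initF ∈ FP`. [cite: AroraBarakCC2009, §1.3] -/
theorem initF_mem_FP : initF ∈ FP := fanoutFn_mem_FP OracleCompose.id_mem_FP (fanoutFn_mem_FP cntF_mem_FP (const_mem_FP _))

/-- **The tabulation** of the `N²` arc bits: the concatenation fold of `arcZ`.
[cite: AroraBarakCC2009, §1.3 (bounded loops)] -/
def tabF : List Bool → List Bool := sndPow 2 ∘ foldLoop appF arcZ (C 400 * (X + 1) ^ 2) ∘ initF

/-- **`tabF ∈ FP`.** [cite: AroraBarakCC2009, §1.3 (bounded loops)] -/
theorem tabF_mem_FP : tabF ∈ FP :=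
  comp_mem_FP (sndPow_mem_FP 2) (comp_mem_FP (foldLoop_mem_FP appF_mem_FP length_appF_le arcZ_mem_FP (C := 1)
    (fun z => by rw [oneBit_arcZ.length_eq]; omega) _) initF_mem_FP)

/-- `N ≤ 20 (|w| + 1)`: the vertex count is linear in the code length. [folklore] -/
theorem nV_le (φ : CNF ℕ) : nV φ.length ≤ 20 * ((encodingCNF.encode φ).length + 1) := by
  have := three_mul_length_le_length_encode φ
  unfold nV; omega

/-- **Value of the tabulation on a code**: the arc bits at the flat indices. [cite: AroraBarakCC2009, Thm. 2.17 (proof: the reduction)] -/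
theorem tabF_encode (φ : CNF ℕ) (hne : ∀ c ∈ φ, c ≠ []) :
    tabF (encodingCNF.encode φ) = List.ofFn fun k : Fin (nV φ.length * nV φ.length) =>
      decide (arcQ φ.length (V φ) (Pb φ) (k / nV φ.length) (k % nV φ.length)) := by
  set w := encodingCNF.encode φ with hw
  set Nv := nV φ.length with hN
  have hNpos : 0 < Nv := by simp only [hN, nV]; omega
  have hk : Nv * Nv ≤ (C 400 * (X + 1) ^ 2 : ℕ[X]).eval w.length := by
    have h := nV_le φ
    simp only [eval_mul, eval_C, eval_pow, eval_add, eval_X, eval_one]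
    rw [← hw, ← hN] at h
    nlinarith
  have hinit : initF w = boolPair w (boolPair (encodeNat (Nv * Nv)) (boolPair (ones 0) [])) := by
    simp [initF, hw, hN, ones]
  rw [tabF, Function.comp_apply, Function.comp_apply, hinit, foldLoop_apply appF arcZ hk 0 [], sndPow_succ_boolPair,
    sndPow_succ_boolPair, sndPow_zero_boolPair, foldAcc_appF, List.nil_append]
  refine DHamRed.ccat_eq_ofFn fun j hj => ?_
  rw [Nat.zero_add]
  exact arcZ_zK hne (Nat.div_lt_of_lt_mul hj) (Nat.mod_lt _ hNpos) (uZ_zK φ j) (vZ_zK φ j)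

/-- The size numeral `bin N` of the output. [folklore] -/
def sizeF : List Bool → List Bool := lenBinF ∘ nW

/-- `sizeF ∈ FP`. [cite: AroraBarakCC2009, §1.3] -/
theorem sizeF_mem_FP : sizeF ∈ FP := comp_mem_FP lenBinF_mem_FP nW_mem_FP

/-- Value of `sizeF` on a code. [folklore] -/
@[simp] theorem sizeF_encode (φ : CNF ℕ) : sizeF (encodingCNF.encode φ) = encodeNat (nV φ.length) := by
  simp [sizeF, ones]

/-- The test "no clause is empty" (every clause code has a nonempty header). [folklore] -/
def noEmptyF : List Bool → List Bool := allFn (notFn (isNilFn ∘ fstF ∘ sndF)) ∘ fanoutFn zeroZ sndF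

/-- `noEmptyF ∈ FP`. [cite: AroraBarakCC2009, §1.3] -/
theorem noEmptyF_mem_FP : noEmptyF ∈ FP :=
  comp_mem_FP (allFn_mem_FP (notFn_mem_FP (comp_mem_FP isNilFn_mem_FP (comp_mem_FP fstF_mem_FP sndF_mem_FP)))
    (oneBit_notFn (oneBit_isNilFn.comp _))) (fanoutFn_mem_FP zeroZ_mem_FP sndF_mem_FP)

/-- `noEmptyF` is one-bit. [folklore] -/
theorem oneBit_noEmptyF : OneBit noEmptyF := (oneBit_allFn (oneBit_notFn (oneBit_isNilFn.comp _))).comp _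

/-- **Value of `noEmptyF` on a code.** [folklore] -/
theorem noEmptyF_encode (φ : CNF ℕ) : noEmptyF (encodingCNF.encode φ) = [decide (∀ c ∈ φ, c ≠ [])] := by
  rw [noEmptyF, Function.comp_apply, fanoutFn_apply, encodeCNF_eq, sndF_boolPair,
    allFn_boolPair (oneBit_notFn (oneBit_isNilFn.comp _)), decNil_encList]
  congr 1
  apply Bool.decide_congr
  simp only [List.forall_mem_map]
  refine forall₂_congr fun c _ => ?_
  rw [notFn_apply (b := decide (fstF (encodingClause.encode c) = [])) (by simp [isNilFn]), encodeClause_eq, fstF_boolPair]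
  simp [ones, List.replicate_eq_nil_iff]

/-- The guard: canonical CNF code, width at most three, no empty clause. [cite: AroraBarakCC2009, §1.3] -/
def guardF : List Bool → List Bool := andFn KSATRed.isCanonFn (andFn (KSATRed.widthLEFn 3) noEmptyF)

/-- `guardF ∈ FP`. [cite: AroraBarakCC2009, §1.3] -/
theorem guardF_mem_FP : guardF ∈ FP :=
  andFn_mem_FP KSATRed.isCanonFn_mem_FP (andFn_mem_FP (KSATRed.widthLEFn_mem_FP 3) noEmptyF_mem_FP)

/-- `guardF` is one-bit. [folklore] -/
theorem oneBit_guardF : OneBit guardF :=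
  oneBit_andFn KSATRed.oneBit_isCanonFn (oneBit_andFn (KSATRed.oneBit_widthLEFn 3) oneBit_noEmptyF)

/-- The guard condition. [folklore] -/
def GuardOK (w : List Bool) : Prop :=
  encodingCNF.encode (decCNF w) = w ∧ (decCNF w).IsWidthLE 3 ∧ ∀ c ∈ decCNF w, c ≠ []

/-- **Truth of the guard.** [folklore] -/
theorem guardF_eq_true_iff (w : List Bool) : guardF w = [true] ↔ GuardOK w := by
  rw [guardF, andFn_eq_true_iff KSATRed.oneBit_isCanonFn (oneBit_andFn (KSATRed.oneBit_widthLEFn 3) oneBit_noEmptyF),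
    andFn_eq_true_iff (KSATRed.oneBit_widthLEFn 3) oneBit_noEmptyF, KSATRed.isCanonFn_apply, GuardOK]
  simp only [List.cons.injEq, and_true, decide_eq_true_eq]
  refine and_congr_right fun hc => ?_
  have hw' : KSATRed.widthLEFn 3 w = [decide (CNF.IsWidthLE 3 (decCNF w))] := by
    conv_lhs => rw [← hc]
    rw [KSATRed.widthLEFn_encode]
  have hn' : noEmptyF w = [decide (∀ c ∈ decCNF w, c ≠ [])] := by
    conv_lhs => rw [← hc]
    rw [noEmptyF_encode]
  rw [hw', hn']
  simp

/-- The fixed non-member: the code of the digraph on no vertices. [folklore] -/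
def badCode : List Bool := boolPair [] []

/-- `badCode ∉ DHAMCIRCUIT` (a yes-instance has a nonempty listing, hence a vertex). [folklore] -/
theorem badCode_not_mem_DHAMCIRCUIT : badCode ∉ DHAMCIRCUIT := by
  rintro ⟨⟨n, A⟩, ⟨l, hl0, hl⟩, he⟩
  rw [encodingDigraph_encode, badCode] at he
  have hn : encodeNat n = [] := (Prod.mk.inj (boolPair_injective (a₁ := (_, _)) (a₂ := (_, _)) he)).1
  have hn0 : n = 0 := by
    have h := congrArg decodeNat hn
    rwa [decode_encodeNat, show decodeNat [] = 0 from rfl] at h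
  subst hn0
  obtain ⟨v, -⟩ := List.exists_mem_of_ne_nil l hl0
  exact v.elim0

/-- **The reduction**: on a guarded code, `⟨bin N, arc bits⟩`; otherwise `badCode`.
[cite: Karp1972, §4 Main Theorem, problem 9] [cite: AroraBarakCC2009, Thm. 2.17] -/
def reduceFn : List Bool → List Bool := iteFn guardF (fanoutFn sizeF tabF) fun _ => badCode

/-- **`reduceFn ∈ FP`.** [cite: AroraBarakCC2009, §1.3] -/
theorem reduceFn_mem_FP : reduceFn ∈ FP := iteFn_mem_FP guardF_mem_FP (fanoutFn_mem_FP sizeF_mem_FP tabF_mem_FP) (const_mem_FP _)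

/-- Value of the reduction off the guard. [folklore] -/
theorem reduceFn_of_not {w : List Bool} (h : ¬GuardOK w) : reduceFn w = badCode := by
  obtain ⟨b, hb⟩ := oneBit_guardF w
  have hf : guardF w = [false] := by
    cases b
    · exact hb
    · exact absurd ((guardF_eq_true_iff w).1 hb) h
  rw [reduceFn, iteFn_apply_false hf]

/-- **Value of the reduction on a guarded code**: the code of the output digraph.
[cite: Karp1972, §4 Main Theorem, problem 9] [cite: AroraBarakCC2009, Thm. 2.17 (proof: the reduction)] -/
theorem reduceFn_encode (φ : CNF ℕ) (hne : ∀ c ∈ φ, c ≠ []) (hw : φ.IsWidthLE 3) :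
    reduceFn (encodingCNF.encode φ) = encodingDigraph.encode ⟨nV φ.length, outDigraph φ⟩ := by
  have hg : guardF (encodingCNF.encode φ) = [true] :=
    (guardF_eq_true_iff _).2 ⟨by rw [KSATRed.decCNF_encode], by rwa [KSATRed.decCNF_encode], by rwa [KSATRed.decCNF_encode]⟩
  rw [reduceFn, iteFn_apply_true hg, fanoutFn_apply, sizeF_encode, tabF_encode φ hne, encodingDigraph_encode]
  dsimp only
  rw [encodingDigraphFin_encode]
  simp only [outDigraph, finProdFinEquiv_symm_apply, Fin.coe_divNat, Fin.coe_modNat]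

end Reduction

end SatDHamRed

/-! ### The Karp reduction and the NP-completeness of HAMILTON CIRCUIT -/

/-- **`3SAT ≤ₚ DIRECTED HAMILTON CIRCUIT`** (Karp 1972, problem 9, here from the 3-CNF form of SAT by the
Arora–Barak chain construction of Thm. 2.17 in cycle form). [cite: Karp1972, §4 Main Theorem, problem 9]
[cite: AroraBarakCC2009, Thm. 2.17] -/
theorem kSAT_three_karpReducible_DHAMCIRCUIT : kSAT 3 ≤ₚ DHAMCIRCUIT := by
  refine ⟨SatDHamRed.reduceFn, SatDHamRed.reduceFn_mem_FP, fun x => ?_⟩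
  show x ∈ kSAT 3 ↔ SatDHamRed.reduceFn x ∈ DHAMCIRCUIT
  by_cases hg : SatDHamRed.GuardOK x
  · obtain ⟨hc, hw, hne⟩ := hg
    rw [← hc, SatDHamRed.reduceFn_encode _ hne hw, encode_mem_DHAMCIRCUIT_iff,
      SatDHamRed.outDigraph_mem_dhamCircuitSet_iff_satisfiable _ hne hw, mem_kSAT_iff]
    exact ⟨fun h => h.2, fun h => ⟨hw, h⟩⟩
  · rw [SatDHamRed.reduceFn_of_not hg]
    constructor
    · intro hx
      exfalso
      apply hg
      have hc := KSATRed.encode_decCNF_of_mem hx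
      rw [← hc, mem_kSAT_iff] at hx
      refine ⟨hc, hx.1, fun c hcm hnil => ?_⟩
      subst hnil
      exact CNF.not_satisfiable_of_nil_mem hcm hx.2
    · intro h
      exact (SatDHamRed.badCode_not_mem_DHAMCIRCUIT h).elim


end Literature.Computability.Complexity

end
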